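import Literature.Analysis.FluidPDE.TaoAveragedRotationAveraging
import Mathlib.Analysis.Distribution.SchwartzSpace.Fourier
import Mathlib.Analysis.Fourier.FourierTransformDeriv
import Mathlib.Analysis.Fourier.Inversion
import HarnessLib

/-!
# Tao 2016, §3.6 (last paragraph): the plane-wave synthesis of a joint weight — proof

T. Tao, *Finite time blowup for an averaged three-dimensional Navier–Stokes equation*,
J. Amer. Math. Soc. **29** (2016), 601–674 = arXiv:1402.0290v3 (held as `paper:arxiv-1402.0290`),
§3.6, p. 18: "By a Fourier expansion and another smooth truncation, we may thus write
`F̃'(R₁,R₂,R₃,ξ₁,ξ₂,ξ₃) = ∫_{ℝ³×ℝ³×ℝ³} f(R₁,R₂,R₃,x₁,x₂,x₃) ∏ⱼ (e^{2πi xⱼ·ξⱼ} mⱼ(ξⱼ)) dx₁dx₂dx₃`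
… where `mⱼ` is a smooth function supported on `B(ξⱼ⁰, 3ε₀³)`, and `f` … is rapidly decreasing in
`x₁,x₂,x₃`, uniformly in `R₁,R₂,R₃`. Inserting this expansion into (3.16), we obtain the desired
expansion (3.15) (taking `Ω` to be `U × ℝ³ × ℝ³ × ℝ³`, with `μ` being Haar measure weighted by `|f|`,
choosing the `m_{j,ω}` to be an appropriately rotated version of `mⱼ`, twisted by a plane wave, and
with `F := f/|f|`)."

This file discharges the named fact `planeWaveSynthesis` of
`TaoAveragedRotationAveraging.lean` (the abstract form of that paragraph: every frequency-side
average `jointWeightAverage μ₀ E ε₀ F` with a smooth compactly supported *joint* weight `F` over a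
measurable family of rotations is the `Ω`-integral of the frequency-side integrand of a genuine
dilation-free complex averaging datum, Def. 3.4 with (3.5)) by carrying out Tao's construction:

* **Fourier expansion** (`PlaneWave.Wsp`, `PlaneWave.splitCLE`, `PlaneWave.Ghat`,
  `PlaneWave.fourier_inversion_F`): the parameter–frequency space `V × ℝ³ × ℝ³`
  (`V = (Fin d → ℝ³)`) is identified with a Euclidean space `W`, the weight `F` (smooth, compactly
  supported, hence Schwartz) is expanded by Fourier inversion,
  `F(ω,ξ₁,ξ₂) = ∫_W f̂(v) e^{2πi(φ(v,ω) + x₁(v)·ξ₁ + x₂(v)·ξ₂)} dv`, the `ω`-dependence being expanded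
  as well (Tao expands only in `ξ`; expanding in `ω` too replaces "rapidly decreasing, uniformly in
  `R`" by the rapid decay of a single Schwartz function `f̂` and a unimodular factor `e^{2πi φ(v,ω)}`).
* **Smooth truncation** (`PlaneWave.chi`, `PlaneWave.pw`): a bump `χ ≡ 1` on the frequency support
  of `F` is inserted, `F = F χ(ξ₁) χ(ξ₂)`, so that the symbols are the plane-wave-twisted bumps
  `e^{2πi x·ξ} χ(ξ)` ("`mⱼ` … twisted by a plane wave"); their symbol seminorms (1.10) grow
  polynomially, `‖e^{2πi x·} χ‖_k ≲ (1+|x|)ᵏ` (`PlaneWave.symbolSeminorm_const_mul_pw_le`, via the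
  representation `e^{2πi x·ξ} χ(ξ) = 𝓕(ψ(· + x))(ξ)`, `ψ = 𝓕⁻¹χ`, and Mathlib's formula for iterated
  derivatives of Fourier integrals).
* **The datum** (`PlaneWave.datum`): `Ω = V × W`, `μ = μ₀ ⊗ |f̂| dv` (finite), symbols
  `m_{1,(ω,v)} = (f̂/|f̂|)(v) e^{2πi φ(v,ω)} e^{2πi x₁(v)·ξ} χ(ξ)`, `m_{2,(ω,v)} = e^{2πi x₂(v)·ξ} χ(ξ)`,
  `m_{3} = 1`, rotations `R_{j,(ω,v)} = Eⱼ(ω)`, no dilations; the integrability conditions (3.5)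
  follow from the seminorm bounds and the decay of `f̂` (`PlaneWave.moment_lt_top`).
* **Inserting the expansion** (`PlaneWave.integral_freqSideIntegrand_datum`): trilinearity of `Λ`,
  Fubini over `Ω = V × W` (integrability from the trilinear bound
  `∫∫ |X₁(ξ₁)| |X₂(ξ₂)| |X₃(ξ₃)| ≤ ‖X₁‖₁ ‖X₂‖₂ ‖X₃‖₂` for `Xⱼ ∈ L¹ ∩ L²` and the frequency
  localisation of the kernel), the density `|f̂|`, the exchange of the `v`- and `ξ`-integrals, and
  Fourier inversion.

`planeWaveSynthesis_holds` assembles these. All intermediate results are proved here; no named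
fact is introduced.

## Design notes

* Measurability of the rotated frequency fields `(θ, ξ) ↦ R_ℂ X(R⁻¹ξ)` for merely a.e. strongly
  measurable `X` uses quasi-measure-preservation of `(θ, ξ₁, ξ₂) ↦ R_θ⁻¹ ξⱼ` on `Ω × ℝ⁶`
  (`PlaneWave.quasiMeasurePreserving_symm_comp`).
* The weight `φ η` of (3.9)/(3.13) is only used through `|φ η| ≤ 1` and its measurability, so the
  identity holds for every real `ε₀`, as the named fact demands.

## References

* T. Tao, J. Amer. Math. Soc. 29 (2016), 601–674, arXiv:1402.0290v3, §1.1 (1.4), (1.10), §3.1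
  Def. 3.4 (3.4)–(3.5), §3.5 (3.13), §3.6 p. 18 ((3.15)–(3.16) and the last paragraph). Key
  `Tao2016AveragedNS`.
-/

noncomputable section

open MeasureTheory Set Filter FourierTransform Metric
open scoped ENNReal NNReal SchwartzMap ComplexConjugate RealInnerProductSpace FourierTransform

namespace Literature.Analysis.FluidPDE.Tao2016

/-- Local notation for physical / frequency space `ℝ³`. -/
local notation "ℝ³" => EuclideanSpace ℝ (Fin 3)
/-- Local notation for the complexified range `ℂ³`. -/
local notation "ℂ³" => EuclideanSpace ℂ (Fin 3)

namespace PlaneWave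

/-- Index type of the flattened parameter–frequency space `V × ℝ³ × ℝ³`, `V = (Fin d → ℝ³)`.
[folklore] -/
abbrev Idx (d : ℕ) : Type := (Fin d × Fin 3) ⊕ (Fin 3 ⊕ Fin 3)

/-- The flattened parameter–frequency space as a Euclidean space (so that Mathlib's Fourier
transform and inversion apply). [folklore] -/
abbrev Wsp (d : ℕ) : Type := EuclideanSpace ℝ (Idx d)

variable (d : ℕ)

/-- The `ω`-coordinates of a point of `Wsp d`. [folklore] -/
def omegaPart (v : Wsp d) : Fin d → ℝ³ := fun i => WithLp.toLp 2 fun j => v (Sum.inl (i, j))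

/-- The `x₁`-coordinates of a point of `Wsp d`. [folklore] -/
def x1Part (v : Wsp d) : ℝ³ := WithLp.toLp 2 fun j => v (Sum.inr (Sum.inl j))

/-- The `x₂`-coordinates of a point of `Wsp d`. [folklore] -/
def x2Part (v : Wsp d) : ℝ³ := WithLp.toLp 2 fun j => v (Sum.inr (Sum.inr j))

/-- Gluing coordinates back. [folklore] -/
def glue (q : (Fin d → ℝ³) × (ℝ³ × ℝ³)) : Wsp d :=
  WithLp.toLp 2 (Sum.elim (fun ij : Fin d × Fin 3 => q.1 ij.1 ij.2)
    (Sum.elim (fun j : Fin 3 => q.2.1 j) (fun j : Fin 3 => q.2.2 j)))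

/-- Coordinates of `glue`: the `ω`-block. [folklore] -/
@[simp] theorem glue_apply_inl (q : (Fin d → ℝ³) × (ℝ³ × ℝ³)) (ij : Fin d × Fin 3) :
    glue d q (Sum.inl ij) = q.1 ij.1 ij.2 := rfl

/-- Coordinates of `glue`: the `x₁`-block. [folklore] -/
@[simp] theorem glue_apply_inr_inl (q : (Fin d → ℝ³) × (ℝ³ × ℝ³)) (j : Fin 3) :
    glue d q (Sum.inr (Sum.inl j)) = q.2.1 j := rfl

/-- Coordinates of `glue`: the `x₂`-block. [folklore] -/
@[simp] theorem glue_apply_inr_inr (q : (Fin d → ℝ³) × (ℝ³ × ℝ³)) (j : Fin 3) :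
    glue d q (Sum.inr (Sum.inr j)) = q.2.2 j := rfl

/-- Coordinates of `omegaPart`. [folklore] -/
@[simp] theorem omegaPart_apply (v : Wsp d) (i : Fin d) (j : Fin 3) :
    omegaPart d v i j = v (Sum.inl (i, j)) := rfl

/-- Coordinates of `x1Part`. [folklore] -/
@[simp] theorem x1Part_apply (v : Wsp d) (j : Fin 3) : x1Part d v j = v (Sum.inr (Sum.inl j)) := rfl

/-- Coordinates of `x2Part`. [folklore] -/
@[simp] theorem x2Part_apply (v : Wsp d) (j : Fin 3) : x2Part d v j = v (Sum.inr (Sum.inr j)) := rfl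

/-- The coordinate splitting `Wsp d ≃ₗ V × (ℝ³ × ℝ³)`. [folklore] -/
def splitLinearEquiv : Wsp d ≃ₗ[ℝ] (Fin d → ℝ³) × (ℝ³ × ℝ³) where
  toFun v := (omegaPart d v, (x1Part d v, x2Part d v))
  invFun := glue d
  map_add' v w := by
    ext i j
    · rfl
    · rfl
    · rfl
  map_smul' c v := by
    ext i j
    · rfl
    · rfl
    · rfl
  left_inv v := by
    ext i
    rcases i with ⟨i, j⟩ | j | j <;> rfl
  right_inv q := by
    ext i j
    · rfl
    · rfl
    · rfl

/-- The coordinate splitting as a continuous linear equivalence. [folklore] -/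
def splitCLE : Wsp d ≃L[ℝ] (Fin d → ℝ³) × (ℝ³ × ℝ³) :=
  (splitLinearEquiv d).toContinuousLinearEquiv

/-- `splitCLE` splits a vector into its three coordinate blocks. [folklore] -/
@[simp] theorem splitCLE_apply (v : Wsp d) :
    splitCLE d v = (omegaPart d v, (x1Part d v, x2Part d v)) := rfl

/-- The inverse of `splitCLE` is `glue`. [folklore] -/
@[simp] theorem splitCLE_symm_apply (q : (Fin d → ℝ³) × (ℝ³ × ℝ³)) :
    (splitCLE d).symm q = glue d q := rfl

/-- The `ω`-phase `∑ᵢ ⟨(omegaPart v) i, ω i⟩`. [folklore] -/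
def omegaPhase (v : Wsp d) (ω : Fin d → ℝ³) : ℝ := ∑ i, ⟪omegaPart d v i, ω i⟫

/-- Splitting of the inner product of `Wsp d` along the coordinates. [folklore] -/
theorem inner_glue (v : Wsp d) (q : (Fin d → ℝ³) × (ℝ³ × ℝ³)) :
    ⟪v, glue d q⟫ = omegaPhase d v q.1 + ⟪x1Part d v, q.2.1⟫ + ⟪x2Part d v, q.2.2⟫ := by
  simp only [omegaPhase, PiLp.inner_apply, RCLike.inner_apply, conj_trivial, Fintype.sum_sum_type,
    Fintype.sum_prod_type, glue_apply_inl, glue_apply_inr_inl, glue_apply_inr_inr, omegaPart_apply,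
    x1Part_apply, x2Part_apply]
  ring

/-- `|x₁(v)| ≤ |v|` (a coordinate block of a Euclidean vector). [folklore] -/
theorem norm_x1Part_le (v : Wsp d) : ‖x1Part d v‖ ≤ ‖v‖ := by
  rw [EuclideanSpace.norm_eq, EuclideanSpace.norm_eq]
  refine Real.sqrt_le_sqrt ?_
  rw [Fintype.sum_sum_type, Fintype.sum_sum_type]
  simp only [x1Part_apply]
  nlinarith [Finset.sum_nonneg (fun i (_ : i ∈ Finset.univ) => sq_nonneg ‖v (Sum.inl i)‖),
    Finset.sum_nonneg (fun j (_ : j ∈ Finset.univ) => sq_nonneg ‖v (Sum.inr (Sum.inr j))‖)]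

/-- `|x₂(v)| ≤ |v|` (a coordinate block of a Euclidean vector). [folklore] -/
theorem norm_x2Part_le (v : Wsp d) : ‖x2Part d v‖ ≤ ‖v‖ := by
  rw [EuclideanSpace.norm_eq, EuclideanSpace.norm_eq]
  refine Real.sqrt_le_sqrt ?_
  rw [Fintype.sum_sum_type, Fintype.sum_sum_type]
  simp only [x2Part_apply]
  nlinarith [Finset.sum_nonneg (fun i (_ : i ∈ Finset.univ) => sq_nonneg ‖v (Sum.inl i)‖),
    Finset.sum_nonneg (fun j (_ : j ∈ Finset.univ) => sq_nonneg ‖v (Sum.inr (Sum.inl j))‖)]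

/-- `x1Part` is continuous (linear). [folklore] -/
theorem continuous_x1Part : Continuous (x1Part d) := (splitCLE d).continuous.snd.fst

/-- `x2Part` is continuous (linear). [folklore] -/
theorem continuous_x2Part : Continuous (x2Part d) := (splitCLE d).continuous.snd.snd

/-- The `ω`-phase is jointly continuous. [folklore] -/
theorem continuous_omegaPhase : Continuous fun q : Wsp d × (Fin d → ℝ³) => omegaPhase d q.1 q.2 := by
  unfold omegaPhase
  refine continuous_finsetSum _ fun i _ => ?_
  exact ((continuous_apply i).comp ((splitCLE d).continuous.fst.comp continuous_fst)).inner
    ((continuous_apply i).comp continuous_snd)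


/-! ### The cut-off bump and the plane-wave-twisted symbols -/

section Symbols

variable (R : ℝ)

/-- A smooth radial bump on `ℝ³`, equal to `1` on the closed ball of radius `max R 0 + 1` and
supported in the closed ball of radius `max R 0 + 2`. [folklore] -/
def cutoff (R : ℝ) : ContDiffBump (0 : ℝ³) :=
  ⟨max R 0 + 1, max R 0 + 2, by positivity, by linarith [le_max_right R 0]⟩

/-- The bump as a real function. [folklore] -/
def chi (R : ℝ) (ξ : ℝ³) : ℝ := cutoff R ξ

/-- `χ = 1` on the closed ball of radius `R`. [folklore] -/
theorem chi_eq_one {R : ℝ} {ξ : ℝ³} (h : ‖ξ‖ ≤ R) : chi R ξ = 1 := by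
  refine (cutoff R).one_of_mem_closedBall ?_
  rw [mem_closedBall, dist_zero_right]
  change ‖ξ‖ ≤ max R 0 + 1
  linarith [le_max_left R 0]

/-- `0 ≤ χ`. [folklore] -/
theorem chi_nonneg (ξ : ℝ³) : 0 ≤ chi R ξ := (cutoff R).nonneg

/-- `χ ≤ 1`. [folklore] -/
theorem chi_le_one (ξ : ℝ³) : chi R ξ ≤ 1 := (cutoff R).le_one

/-- `|χ| ≤ 1`. [folklore] -/
theorem abs_chi_le_one (ξ : ℝ³) : |chi R ξ| ≤ 1 := by
  rw [abs_of_nonneg (chi_nonneg R ξ)]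
  exact chi_le_one R ξ

/-- `χ = 0` outside the ball of radius `max R 0 + 2`. [folklore] -/
theorem chi_eq_zero {R : ℝ} {ξ : ℝ³} (h : max R 0 + 2 ≤ ‖ξ‖) : chi R ξ = 0 := by
  refine (cutoff R).zero_of_le_dist ?_
  rw [dist_zero_right]
  exact h

/-- `χ` is smooth. [folklore] -/
theorem contDiff_chi : ContDiff ℝ ((⊤ : ℕ∞) : WithTop ℕ∞) (chi R) := (cutoff R).contDiff

/-- `χ` is continuous. [folklore] -/
theorem continuous_chi : Continuous (chi R) := (cutoff R).continuous

/-- `χ` has compact support. [folklore] -/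
theorem hasCompactSupport_chi : HasCompactSupport (chi R) := (cutoff R).hasCompactSupport

/-- The topological support of `χ` is the closed ball of radius `max R 0 + 2`. [folklore] -/
theorem tsupport_chi : tsupport (chi R) = closedBall (0 : ℝ³) (max R 0 + 2) :=
  (cutoff R).tsupport_eq

/-- The bump as a complex function. [folklore] -/
def chiC (R : ℝ) (ξ : ℝ³) : ℂ := (chi R ξ : ℂ)

/-- `χ` (complex-valued) is smooth. [folklore] -/
theorem contDiff_chiC : ContDiff ℝ ((⊤ : ℕ∞) : WithTop ℕ∞) (chiC R) :=
  Complex.ofRealCLM.contDiff.comp (contDiff_chi R)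

/-- `χ` (complex-valued) is continuous. [folklore] -/
theorem continuous_chiC : Continuous (chiC R) :=
  Complex.continuous_ofReal.comp (continuous_chi R)

/-- `χ` (complex-valued) has compact support. [folklore] -/
theorem hasCompactSupport_chiC : HasCompactSupport (chiC R) :=
  (hasCompactSupport_chi R).comp_left Complex.ofReal_zero

/-- The support of `χ` (complex-valued) lies in the closed ball of radius `max R 0 + 2`. [folklore] -/
theorem tsupport_chiC : tsupport (chiC R) ⊆ closedBall (0 : ℝ³) (max R 0 + 2) := by
  rw [← tsupport_chi R]
  exact tsupport_comp_subset Complex.ofReal_zero _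

/-- `|χ| ≤ 1` (complex-valued). [folklore] -/
theorem norm_chiC_le_one (ξ : ℝ³) : ‖chiC R ξ‖ ≤ 1 := by
  rw [chiC, Complex.norm_real, Real.norm_eq_abs]
  exact abs_chi_le_one R ξ

/-- The bump as a Schwartz function. [folklore] -/
def chiS (R : ℝ) : 𝓢(ℝ³, ℂ) := (hasCompactSupport_chiC R).toSchwartzMap (contDiff_chiC R)

/-- The Schwartz bump is `χ` pointwise. [folklore] -/
@[simp] theorem chiS_apply (ξ : ℝ³) : chiS R ξ = chiC R ξ := rfl

/-- The inverse Fourier transform of the bump (a Schwartz function), whose translates synthesise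
the plane-wave-twisted bumps. [cite: Tao2016AveragedNS, §3.6 p. 18] -/
def psi (R : ℝ) : 𝓢(ℝ³, ℂ) := 𝓕⁻ (chiS R)

/-- **The plane-wave-twisted bump** `ξ ↦ e^{2πi x·ξ} χ(ξ)` ("`mⱼ` … twisted by a plane wave",
Tao p. 18). [cite: Tao2016AveragedNS, §3.6 p. 18] -/
def pw (R : ℝ) (x : ℝ³) (ξ : ℝ³) : ℂ := (𝐞 ⟪x, ξ⟫ : ℂ) * chiC R ξ

/-- `|e^{2πi x·ξ} χ(ξ)| ≤ 1`. [folklore] -/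
theorem norm_pw_le_one (x ξ : ℝ³) : ‖pw R x ξ‖ ≤ 1 := by
  rw [pw, norm_mul, Circle.norm_coe, one_mul]
  exact norm_chiC_le_one R ξ

/-- The twisted bump is jointly continuous in `(x, ξ)`. [folklore] -/
theorem continuous_pw_uncurry : Continuous fun q : ℝ³ × ℝ³ => pw R q.1 q.2 := by
  unfold pw
  refine Continuous.mul ?_ ((continuous_chiC R).comp continuous_snd)
  exact continuous_induced_dom.comp' (Real.continuous_fourierChar.comp
    (continuous_fst.inner continuous_snd))

/-- The twisted bump is smooth in `ξ`. [folklore] -/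
theorem contDiff_pw (x : ℝ³) : ContDiff ℝ ((⊤ : ℕ∞) : WithTop ℕ∞) (pw R x) := by
  unfold pw
  refine ContDiff.mul ?_ (contDiff_chiC R)
  have h : (fun ξ : ℝ³ => ((𝐞 ⟪x, ξ⟫ : Circle) : ℂ)) =
      fun ξ => Complex.exp ((2 * Real.pi * Complex.I) • (Complex.ofRealCLM (innerSL ℝ x ξ))) := by
    funext ξ
    rw [Real.fourierChar_apply, innerSL_apply_apply, smul_eq_mul, Complex.ofRealCLM_apply]
    congr 1
    push_cast
    ring
  rw [h]
  exact Complex.contDiff_exp.comp (((Complex.ofRealCLM).contDiff.comp (innerSL ℝ x).contDiff).const_smul _)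

/-- The plane-wave-twisted bump is the Fourier transform of a translate of `psi`. [folklore] -/
theorem pw_eq_fourier (x : ℝ³) : pw R x = 𝓕 (fun v : ℝ³ => psi R (v + x)) := by
  have h1 : (fun v : ℝ³ => psi R (v + x)) = ⇑(psi R) ∘ fun v => v + x := rfl
  rw [h1]
  change _ = VectorFourier.fourierIntegral 𝐞 volume (innerₗ ℝ³) (⇑(psi R) ∘ fun v => v + x)
  rw [VectorFourier.fourierIntegral_comp_add_right]
  funext ξ
  have h2 : VectorFourier.fourierIntegral 𝐞 volume (innerₗ ℝ³) ⇑(psi R) ξ = chiC R ξ := by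
    change (𝓕 (⇑(psi R))) ξ = _
    rw [← SchwartzMap.fourier_coe, psi, fourier_fourierInv_eq]
    rfl
  rw [h2, innerₗ_apply_apply, Circle.smul_def, smul_eq_mul]
  rfl

/-- The weighted moments of `psi`. [folklore] -/
def psiMoment (R : ℝ) (k : ℕ) : ℝ := ∫ u : ℝ³, ‖u‖ ^ k * ‖psi R u‖

/-- The moments of `ψ` are non-negative. [folklore] -/
theorem psiMoment_nonneg (k : ℕ) : 0 ≤ psiMoment R k :=
  integral_nonneg fun _ => by positivity

/-- `‖v‖ⁿ |ψ(v + x)|` is integrable (Schwartz decay of `ψ`, translation invariance). [folklore] -/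
theorem integrable_pow_mul_psi_translate (x : ℝ³) (n : ℕ) :
    Integrable (fun v : ℝ³ => ‖v‖ ^ n * ‖psi R (v + x)‖) := by
  have h1 : Integrable (fun v : ℝ³ => ‖v + x‖ ^ n * ‖psi R (v + x)‖) :=
    ((psi R).integrable_pow_mul volume n).comp_add_right x
  have h2 : Integrable (fun v : ℝ³ => ‖psi R (v + x)‖) :=
    ((psi R).integrable.norm).comp_add_right x
  refine ((h1.add (h2.const_mul (‖x‖ ^ n))).const_mul (2 ^ (n - 1))).mono' ?_ ?_
  · exact ((continuous_norm.pow n).mul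
      ((psi R).continuous.comp (continuous_id.add continuous_const)).norm).aestronglyMeasurable
  · refine Eventually.of_forall fun v => ?_
    rw [Real.norm_eq_abs, abs_of_nonneg (by positivity)]
    have hv : ‖v‖ ≤ ‖v + x‖ + ‖x‖ := by
      calc ‖v‖ = ‖(v + x) - x‖ := by rw [add_sub_cancel_right]
        _ ≤ ‖v + x‖ + ‖x‖ := norm_sub_le _ _
    have hpow : ‖v‖ ^ n ≤ 2 ^ (n - 1) * (‖v + x‖ ^ n + ‖x‖ ^ n) :=
      (pow_le_pow_left₀ (norm_nonneg _) hv n).trans (add_pow_le (norm_nonneg _) (norm_nonneg _) n)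
    calc ‖v‖ ^ n * ‖psi R (v + x)‖ ≤ 2 ^ (n - 1) * (‖v + x‖ ^ n + ‖x‖ ^ n) * ‖psi R (v + x)‖ :=
          mul_le_mul_of_nonneg_right hpow (norm_nonneg _)
      _ = 2 ^ (n - 1) * (‖v + x‖ ^ n * ‖psi R (v + x)‖ + ‖x‖ ^ n * ‖psi R (v + x)‖) := by ring

/-- `∫ ‖v‖ᵏ |ψ(v + x)| dv ≤ 2ᵏ (M_k + M_0) (1 + |x|)ᵏ`. [folklore] -/
theorem integral_pow_mul_psi_translate_le (x : ℝ³) (k : ℕ) :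
    ∫ v : ℝ³, ‖v‖ ^ k * ‖psi R (v + x)‖ ≤
      2 ^ k * (psiMoment R k + psiMoment R 0) * (1 + ‖x‖) ^ k := by
  have hchange : ∫ v : ℝ³, ‖v‖ ^ k * ‖psi R (v + x)‖ = ∫ u : ℝ³, ‖u - x‖ ^ k * ‖psi R u‖ := by
    rw [← integral_add_right_eq_self (fun u : ℝ³ => ‖u - x‖ ^ k * ‖psi R u‖) x]
    simp only [add_sub_cancel_right]
  rw [hchange]
  have hA : Integrable (fun u : ℝ³ => ‖u‖ ^ k * ‖psi R u‖) := (psi R).integrable_pow_mul volume k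
  have hB : Integrable (fun u : ℝ³ => ‖psi R u‖) := (psi R).integrable.norm
  have hle : ∀ u : ℝ³, ‖u - x‖ ^ k * ‖psi R u‖ ≤
      2 ^ (k - 1) * (‖u‖ ^ k * ‖psi R u‖ + ‖x‖ ^ k * ‖psi R u‖) := fun u => by
    have h1 : ‖u - x‖ ^ k ≤ 2 ^ (k - 1) * (‖u‖ ^ k + ‖x‖ ^ k) :=
      (pow_le_pow_left₀ (norm_nonneg _) (norm_sub_le u x) k).trans
        (add_pow_le (norm_nonneg _) (norm_nonneg _) k)
    calc ‖u - x‖ ^ k * ‖psi R u‖ ≤ 2 ^ (k - 1) * (‖u‖ ^ k + ‖x‖ ^ k) * ‖psi R u‖ :=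
          mul_le_mul_of_nonneg_right h1 (norm_nonneg _)
      _ = _ := by ring
  calc ∫ u : ℝ³, ‖u - x‖ ^ k * ‖psi R u‖
      ≤ ∫ u : ℝ³, 2 ^ (k - 1) * (‖u‖ ^ k * ‖psi R u‖ + ‖x‖ ^ k * ‖psi R u‖) :=
        integral_mono_of_nonneg (Eventually.of_forall fun u => by positivity)
          ((hA.add (hB.const_mul _)).const_mul _) (Eventually.of_forall hle)
    _ = 2 ^ (k - 1) * (psiMoment R k + ‖x‖ ^ k * psiMoment R 0) := by
        rw [integral_const_mul, integral_add hA (hB.const_mul _), integral_const_mul]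
        simp [psiMoment]
    _ ≤ 2 ^ k * (psiMoment R k + psiMoment R 0) * (1 + ‖x‖) ^ k := by
        have h0 := psiMoment_nonneg R 0
        have hk := psiMoment_nonneg R k
        have hx1 : (1 : ℝ) ≤ (1 + ‖x‖) ^ k := one_le_pow₀ (by linarith [norm_nonneg x])
        have hx2 : ‖x‖ ^ k ≤ (1 + ‖x‖) ^ k :=
          pow_le_pow_left₀ (norm_nonneg _) (by linarith [norm_nonneg x]) k
        have h2 : (2 : ℝ) ^ (k - 1) ≤ 2 ^ k := pow_le_pow_right₀ one_le_two (Nat.sub_le k 1)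
        have e1 : psiMoment R k ≤ psiMoment R k * (1 + ‖x‖) ^ k := le_mul_of_one_le_right hk hx1
        have e2 : ‖x‖ ^ k * psiMoment R 0 ≤ (1 + ‖x‖) ^ k * psiMoment R 0 :=
          mul_le_mul_of_nonneg_right hx2 h0
        have e4 : (0 : ℝ) ≤ psiMoment R k + ‖x‖ ^ k * psiMoment R 0 := by positivity
        calc 2 ^ (k - 1) * (psiMoment R k + ‖x‖ ^ k * psiMoment R 0)
            ≤ 2 ^ k * (psiMoment R k * (1 + ‖x‖) ^ k + (1 + ‖x‖) ^ k * psiMoment R 0) :=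
              mul_le_mul h2 (add_le_add e1 e2) e4 (by positivity)
          _ = 2 ^ k * (psiMoment R k + psiMoment R 0) * (1 + ‖x‖) ^ k := by ring

/-- The constant in the derivative bound for the plane-wave-twisted bump. [folklore] -/
def pwDerivConst (R : ℝ) (k : ℕ) : ℝ := (2 * Real.pi) ^ k * (2 ^ k * (psiMoment R k + psiMoment R 0))

/-- The derivative constant is non-negative. [folklore] -/
theorem pwDerivConst_nonneg (k : ℕ) : 0 ≤ pwDerivConst R k := by
  have := psiMoment_nonneg R k
  have := psiMoment_nonneg R 0
  unfold pwDerivConst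
  positivity

/-- **`‖∇ᵏ(e^{2πi x·ξ} χ(ξ))‖ ≲ₖ (1 + |x|)ᵏ`**, via the Fourier representation of the twisted bump
and Mathlib's formula for iterated derivatives of Fourier integrals.
[cite: Tao2016AveragedNS, §3.6 p. 18] -/
theorem norm_iteratedFDeriv_pw_le (k : ℕ) (x ξ : ℝ³) :
    ‖iteratedFDeriv ℝ k (pw R x) ξ‖ ≤ pwDerivConst R k * (1 + ‖x‖) ^ k := by
  rw [pw_eq_fourier]
  set g : ℝ³ → ℂ := fun v => psi R (v + x) with hg
  have hg_int : ∀ n : ℕ, (n : ℕ∞) ≤ (k : ℕ∞) → Integrable (fun v => ‖v‖ ^ n * ‖g v‖) :=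
    fun n _ => integrable_pow_mul_psi_translate R x n
  have hg_meas : AEStronglyMeasurable g volume :=
    ((psi R).continuous.comp (continuous_id.add continuous_const)).aestronglyMeasurable
  rw [Real.iteratedFDeriv_fourier hg_int hg_meas le_rfl]
  have hL : ‖innerSL ℝ (E := ℝ³)‖ ≤ 1 := norm_innerSL_le ℝ
  calc ‖𝓕 (fun v => VectorFourier.fourierPowSMulRight (innerSL ℝ) g v k) ξ‖
      ≤ ∫ v, ‖VectorFourier.fourierPowSMulRight (innerSL ℝ) g v k‖ :=
        VectorFourier.norm_fourierIntegral_le_integral_norm _ _ _ _ _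
    _ ≤ ∫ v, (2 * Real.pi) ^ k * (‖v‖ ^ k * ‖g v‖) := by
        refine integral_mono_of_nonneg (Eventually.of_forall fun _ => norm_nonneg _)
          ((hg_int k le_rfl).const_mul _) (Eventually.of_forall fun v => ?_)
        refine (VectorFourier.norm_fourierPowSMulRight_le (innerSL ℝ) g v k).trans ?_
        rw [mul_assoc]
        refine mul_le_mul_of_nonneg_right ?_ (by positivity)
        refine pow_le_pow_left₀ (by positivity) ?_ k
        calc 2 * Real.pi * ‖innerSL ℝ (E := ℝ³)‖ ≤ 2 * Real.pi * 1 := by gcongr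
          _ = 2 * Real.pi := mul_one _
    _ = (2 * Real.pi) ^ k * ∫ v, ‖v‖ ^ k * ‖g v‖ := integral_const_mul _ _
    _ ≤ (2 * Real.pi) ^ k * (2 ^ k * (psiMoment R k + psiMoment R 0) * (1 + ‖x‖) ^ k) :=
        mul_le_mul_of_nonneg_left (integral_pow_mul_psi_translate_le R x k) (by positivity)
    _ = pwDerivConst R k * (1 + ‖x‖) ^ k := by unfold pwDerivConst; ring

/-- The twisted bump is supported in the closed ball of radius `max R 0 + 2`. [folklore] -/
theorem tsupport_pw_subset (x : ℝ³) : tsupport (pw R x) ⊆ closedBall (0 : ℝ³) (max R 0 + 2) :=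
  (tsupport_mul_subset_right (f := fun ξ : ℝ³ => ((𝐞 ⟪x, ξ⟫ : Circle) : ℂ)) (g := chiC R)).trans
    (tsupport_chiC R)

/-- The constant in the symbol-seminorm bound. [folklore] -/
def pwSymbolConst (R : ℝ) (k : ℕ) : ℝ := (max R 0 + 2) ^ k * pwDerivConst R k

/-- The symbol constant is non-negative. [folklore] -/
theorem pwSymbolConst_nonneg (k : ℕ) : 0 ≤ pwSymbolConst R k := by
  have := pwDerivConst_nonneg R k
  unfold pwSymbolConst
  positivity

/-- **Symbol seminorms of a unimodular multiple of the twisted bump**: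
`‖c e^{2πi x·} χ‖_k ≤ C_k (1 + |x|)ᵏ` for `|c| ≤ 1` ("`‖e^{2πi x·ξ} m(ξ)‖_k ≲ (1+|x|)ᵏ`"). [cite: Tao2016AveragedNS, §3.6 p. 18 and (1.10)] -/
theorem symbolSeminorm_const_mul_pw_le (k : ℕ) (x : ℝ³) {c : ℂ} (hc : ‖c‖ ≤ 1) :
    symbolSeminorm k (fun ξ => c * pw R x ξ) ≤
      ENNReal.ofReal (pwSymbolConst R k * (1 + ‖x‖) ^ k) := by
  unfold symbolSeminorm
  refine iSup₂_le fun ξ _ => ?_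
  have hsmul : iteratedFDeriv ℝ k (fun ξ => c * pw R x ξ) ξ = c • iteratedFDeriv ℝ k (pw R x) ξ := by
    have := iteratedFDeriv_const_smul_apply' (a := c) (f := pw R x) (x := ξ) (i := k)
      ((contDiff_pw R x).contDiffAt.of_le (mod_cast le_top))
    simpa only [smul_eq_mul] using this
  rw [hsmul]
  have hreal : ‖ξ‖ ^ k * ‖c • iteratedFDeriv ℝ k (pw R x) ξ‖ ≤ pwSymbolConst R k * (1 + ‖x‖) ^ k := by
    by_cases hξ : ξ ∈ closedBall (0 : ℝ³) (max R 0 + 2)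
    · rw [mem_closedBall, dist_zero_right] at hξ
      rw [norm_smul]
      calc ‖ξ‖ ^ k * (‖c‖ * ‖iteratedFDeriv ℝ k (pw R x) ξ‖)
          ≤ (max R 0 + 2) ^ k * (1 * (pwDerivConst R k * (1 + ‖x‖) ^ k)) :=
            mul_le_mul (pow_le_pow_left₀ (norm_nonneg _) hξ k)
              (mul_le_mul hc (norm_iteratedFDeriv_pw_le R k x ξ) (norm_nonneg _) zero_le_one)
              (by positivity) (by positivity)
        _ = pwSymbolConst R k * (1 + ‖x‖) ^ k := by unfold pwSymbolConst; ring
    · have h0 : iteratedFDeriv ℝ k (pw R x) ξ = 0 := by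
        by_contra hne
        exact hξ (tsupport_pw_subset R x (support_iteratedFDeriv_subset k (Function.mem_support.2 hne)))
      rw [h0, smul_zero, norm_zero, mul_zero]
      exact mul_nonneg (pwSymbolConst_nonneg R k) (by positivity)
  calc (‖ξ‖₊ : ℝ≥0∞) ^ k * ‖c • iteratedFDeriv ℝ k (pw R x) ξ‖₊
      = ENNReal.ofReal (‖ξ‖ ^ k * ‖c • iteratedFDeriv ℝ k (pw R x) ξ‖) := by
        rw [ENNReal.ofReal_mul (by positivity), ENNReal.ofReal_pow (norm_nonneg _), ofReal_norm,
          ofReal_norm, enorm_eq_nnnorm, enorm_eq_nnnorm]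
    _ ≤ ENNReal.ofReal (pwSymbolConst R k * (1 + ‖x‖) ^ k) := ENNReal.ofReal_le_ofReal hreal

/-- A unimodular multiple of the twisted bump is a complex Fourier multiplier of order `0`. [cite: Tao2016AveragedNS, §3.6 p. 18] -/
theorem isComplexSymbol_const_mul_pw (x : ℝ³) {c : ℂ} (hc : ‖c‖ ≤ 1) :
    IsComplexSymbol fun ξ => c * pw R x ξ :=
  ⟨(contDiff_const.mul (contDiff_pw R x)).contDiffOn, fun k =>
    lt_of_le_of_lt (symbolSeminorm_const_mul_pw_le R k x hc) ENNReal.ofReal_lt_top⟩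

end Symbols


/-! ### Measurability of rotated frequency fields over a parameter space -/

section Measurability

variable {A : Type*} [MeasurableSpace A]

/-- `(a, ξ) ↦ (S a)⁻¹ ξ` is jointly measurable for a pointwise measurable rotation family.
[folklore] -/
theorem measurable_symm_apply {S : A → (ℝ³ ≃ₗᵢ[ℝ] ℝ³)} (hS : ∀ x, Measurable fun a => S a x) :
    Measurable fun q : A × ℝ³ => (S q.1).symm q.2 := by
  have h : (fun q : A × ℝ³ => (S q.1).symm q.2) =
      fun q => WithLp.toLp 2 fun j => ⟪S q.1 (EuclideanSpace.single j (1 : ℝ)), q.2⟫ := by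
    funext q
    ext j
    rw [PiLp.toLp_apply]
    exact symm_apply_coord _ _ _
  rw [h]
  refine (WithLp.measurable_toLp 2 _).comp (measurable_pi_lambda _ fun j => ?_)
  exact continuous_inner.measurable.comp (((hS _).comp measurable_fst).prodMk measurable_snd)

/-- `(a, z) ↦ (S a)_ℂ Φ(a, z)` is measurable for measurable `Φ`. [folklore] -/
theorem measurable_rotMat_apply {X : Type*} [MeasurableSpace X] {S : A → (ℝ³ ≃ₗᵢ[ℝ] ℝ³)}
    (hS : ∀ x, Measurable fun a => S a x) {Φ : A × X → ℂ³} (hΦ : Measurable Φ) :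
    Measurable fun q : A × X => rotMat (S q.1) (Φ q) := by
  have h : (fun q : A × X => rotMat (S q.1) (Φ q)) =
      fun q => WithLp.toLp 2 fun j =>
        ∑ k, (((S q.1 (EuclideanSpace.single k (1 : ℝ))) j : ℝ) : ℂ) * Φ q k := by
    funext q
    ext j
    rw [PiLp.toLp_apply, rotMat, complexifyCLM_apply]
    rfl
  rw [h]
  refine (WithLp.measurable_toLp 2 _).comp (measurable_pi_lambda _ fun j => ?_)
  refine Finset.measurable_fun_sum _ fun k _ => Measurable.mul ?_ ?_
  · exact Complex.measurable_ofReal.comp ((measurable_pi_apply j).comp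
      ((WithLp.measurable_ofLp 2 _).comp ((hS _).comp measurable_fst)))
  · exact (measurable_pi_apply k).comp ((WithLp.measurable_ofLp 2 _).comp hΦ)

/-- `(a, p) ↦ (S a)⁻¹ π(p)` is quasi-measure-preserving on `A × ℝ⁶` for a quasi-measure-preserving
coordinate map `π : ℝ⁶ → ℝ³`. [folklore] -/
theorem quasiMeasurePreserving_symm_comp (κ : Measure A) {S : A → (ℝ³ ≃ₗᵢ[ℝ] ℝ³)}
    (hS : ∀ x, Measurable fun a => S a x) {π : ℝ³ × ℝ³ → ℝ³} (hπm : Measurable π)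
    (hπ : Measure.QuasiMeasurePreserving π ((volume : Measure ℝ³).prod volume) volume) :
    Measure.QuasiMeasurePreserving (fun q : A × (ℝ³ × ℝ³) => (S q.1).symm (π q.2))
      (κ.prod ((volume : Measure ℝ³).prod volume)) volume := by
  refine QuasiMeasurePreserving.prod_of_right ?_ (Eventually.of_forall fun a => ?_)
  · exact (measurable_symm_apply hS).comp (measurable_fst.prodMk (hπm.comp measurable_snd))
  · exact (S a).symm.measurePreserving.quasiMeasurePreserving.comp hπ

/-- The pulled-back frequency field `(a, p) ↦ X((S a)⁻¹ π(p))` is a.e. strongly measurable on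
`A × ℝ⁶` for `X` a.e. strongly measurable on `ℝ³`. [folklore] -/
theorem aestronglyMeasurable_field (κ : Measure A) {S : A → (ℝ³ ≃ₗᵢ[ℝ] ℝ³)}
    (hS : ∀ x, Measurable fun a => S a x) {π : ℝ³ × ℝ³ → ℝ³} (hπm : Measurable π)
    (hπ : Measure.QuasiMeasurePreserving π ((volume : Measure ℝ³).prod volume) volume)
    {X : ℝ³ → ℂ³} (hX : AEStronglyMeasurable X volume) :
    AEStronglyMeasurable (fun q : A × (ℝ³ × ℝ³) => X ((S q.1).symm (π q.2)))
      (κ.prod ((volume : Measure ℝ³).prod volume)) :=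
  hX.comp_quasiMeasurePreserving (quasiMeasurePreserving_symm_comp κ hS hπm hπ)

/-- The rotated frequency field `(a, p) ↦ (S a)_ℂ X((S a)⁻¹ π(p))` is a.e. strongly measurable on
`A × ℝ⁶` for `X` a.e. strongly measurable on `ℝ³`. [folklore] -/
theorem aestronglyMeasurable_rotField (κ : Measure A) {S : A → (ℝ³ ≃ₗᵢ[ℝ] ℝ³)}
    (hS : ∀ x, Measurable fun a => S a x) {π : ℝ³ × ℝ³ → ℝ³} (hπm : Measurable π)
    (hπ : Measure.QuasiMeasurePreserving π ((volume : Measure ℝ³).prod volume) volume)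
    {X : ℝ³ → ℂ³} (hX : AEStronglyMeasurable X volume) :
    AEStronglyMeasurable (fun q : A × (ℝ³ × ℝ³) => rotMat (S q.1) (X ((S q.1).symm (π q.2))))
      (κ.prod ((volume : Measure ℝ³).prod volume)) := by
  obtain ⟨Z, hZm, hZeq⟩ := aestronglyMeasurable_field κ hS hπm hπ hX
  refine ⟨fun q => rotMat (S q.1) (Z q), (measurable_rotMat_apply hS hZm.measurable).stronglyMeasurable,
    ?_⟩
  filter_upwards [hZeq] with q hq
  simp only [hq]

variable (S : Fin 3 → A → (ℝ³ ≃ₗᵢ[ℝ] ℝ³))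

/-- `Λ` of the three rotated frequency fields. [cite: Tao2016AveragedNS, (1.4) and §3.5 p. 17] -/
def LamRot (X₁ X₂ X₃ : ℝ³ → ℂ³) (a : A) (p : ℝ³ × ℝ³) : ℂ :=
  Λ p.1 p.2 (rotMat (S 0 a) (X₁ ((S 0 a).symm p.1))) (rotMat (S 1 a) (X₂ ((S 1 a).symm p.2)))
    (rotMat (S 2 a) (X₃ ((S 2 a).symm (-p.1 - p.2))))

/-- The product of the norms of the three rotated frequency fields. [folklore] -/
def normProd (X₁ X₂ X₃ : ℝ³ → ℂ³) (a : A) (p : ℝ³ × ℝ³) : ℝ :=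
  ‖X₁ ((S 0 a).symm p.1)‖ * ‖X₂ ((S 1 a).symm p.2)‖ * ‖X₃ ((S 2 a).symm (-p.1 - p.2))‖

omit [MeasurableSpace A] in
/-- `normProd` is non-negative. [folklore] -/
theorem normProd_nonneg (X₁ X₂ X₃ : ℝ³ → ℂ³) (a : A) (p : ℝ³ × ℝ³) : 0 ≤ normProd S X₁ X₂ X₃ a p := by
  unfold normProd
  positivity

omit [MeasurableSpace A] in
/-- Pointwise bound `|Λ(Y₁,Y₂,Y₃)| ≤ (|ξ₁| + |ξ₂|) |X₁| |X₂| |X₃|` for the rotated fields.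
[cite: Tao2016AveragedNS, (1.4)] -/
theorem norm_LamRot_le (X₁ X₂ X₃ : ℝ³ → ℂ³) (a : A) (p : ℝ³ × ℝ³) :
    ‖LamRot S X₁ X₂ X₃ a p‖ ≤ (‖p.1‖ + ‖p.2‖) * normProd S X₁ X₂ X₃ a p := by
  unfold LamRot normProd
  refine (norm_Λ_le _ _ _ _ _).trans ?_
  rw [rotMat, rotMat, rotMat, norm_complexifyCLM, norm_complexifyCLM, norm_complexifyCLM]
  nlinarith [norm_nonneg p.1, norm_nonneg p.2, norm_nonneg (X₁ ((S 0 a).symm p.1)),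
    norm_nonneg (X₂ ((S 1 a).symm p.2)), norm_nonneg (X₃ ((S 2 a).symm (-p.1 - p.2))),
    mul_nonneg (mul_nonneg (norm_nonneg (X₁ ((S 0 a).symm p.1))) (norm_nonneg (X₂ ((S 1 a).symm p.2))))
      (norm_nonneg (X₃ ((S 2 a).symm (-p.1 - p.2))))]

variable {S}

/-- `(ξ₁, ξ₂) ↦ ξ₃ = -ξ₁ - ξ₂` is measurable. [folklore] -/
theorem measurable_neg_fst_sub_snd : Measurable fun p : ℝ³ × ℝ³ => -p.1 - p.2 :=
  (continuous_fst.neg.sub continuous_snd).measurable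

/-- `LamRot` is a.e. strongly measurable on `A × ℝ⁶`. [folklore] -/
theorem aestronglyMeasurable_LamRot (κ : Measure A) (hS : ∀ j x, Measurable fun a => S j a x)
    {X₁ X₂ X₃ : ℝ³ → ℂ³} (hX₁ : AEStronglyMeasurable X₁ volume)
    (hX₂ : AEStronglyMeasurable X₂ volume) (hX₃ : AEStronglyMeasurable X₃ volume) :
    AEStronglyMeasurable (fun q : A × (ℝ³ × ℝ³) => LamRot S X₁ X₂ X₃ q.1 q.2)
      (κ.prod ((volume : Measure ℝ³).prod volume)) := by
  have h0 := aestronglyMeasurable_rotField κ (hS 0) measurable_fst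
    Measure.quasiMeasurePreserving_fst hX₁
  have h1 := aestronglyMeasurable_rotField κ (hS 1) measurable_snd
    Measure.quasiMeasurePreserving_snd hX₂
  have h2 := aestronglyMeasurable_rotField κ (hS 2) measurable_neg_fst_sub_snd
    quasiMeasurePreserving_neg_fst_sub_snd hX₃
  have hp : AEStronglyMeasurable (fun q : A × (ℝ³ × ℝ³) => q.2)
      (κ.prod ((volume : Measure ℝ³).prod volume)) := measurable_snd.aestronglyMeasurable
  have heq : (fun q : A × (ℝ³ × ℝ³) => LamRot S X₁ X₂ X₃ q.1 q.2) =
      (fun r : (ℝ³ × ℝ³) × (ℂ³ × ℂ³ × ℂ³) => Λ r.1.1 r.1.2 r.2.1 r.2.2.1 r.2.2.2) ∘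
        fun q : A × (ℝ³ × ℝ³) => (q.2, (rotMat (S 0 q.1) (X₁ ((S 0 q.1).symm q.2.1)),
          (rotMat (S 1 q.1) (X₂ ((S 1 q.1).symm q.2.2)),
            rotMat (S 2 q.1) (X₃ ((S 2 q.1).symm (-q.2.1 - q.2.2)))))) := by
    funext q
    rfl
  rw [heq]
  exact continuous_Λ.comp_aestronglyMeasurable (hp.prodMk (h0.prodMk (h1.prodMk h2)))

/-- `normProd` is a.e. strongly measurable on `A × ℝ⁶`. [folklore] -/
theorem aestronglyMeasurable_normProd (κ : Measure A) (hS : ∀ j x, Measurable fun a => S j a x)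
    {X₁ X₂ X₃ : ℝ³ → ℂ³} (hX₁ : AEStronglyMeasurable X₁ volume)
    (hX₂ : AEStronglyMeasurable X₂ volume) (hX₃ : AEStronglyMeasurable X₃ volume) :
    AEStronglyMeasurable (fun q : A × (ℝ³ × ℝ³) => normProd S X₁ X₂ X₃ q.1 q.2)
      (κ.prod ((volume : Measure ℝ³).prod volume)) := by
  have h0 := aestronglyMeasurable_field κ (hS 0) measurable_fst
    Measure.quasiMeasurePreserving_fst hX₁
  have h1 := aestronglyMeasurable_field κ (hS 1) measurable_snd
    Measure.quasiMeasurePreserving_snd hX₂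
  have h2 := aestronglyMeasurable_field κ (hS 2) measurable_neg_fst_sub_snd
    quasiMeasurePreserving_neg_fst_sub_snd hX₃
  unfold normProd
  exact (h0.norm.mul h1.norm).mul h2.norm

/-! ### The trilinear `L¹ × L² × L²` bound -/

/-- `L¹` size of a frequency field. [folklore] -/
def L1e (X : ℝ³ → ℂ³) : ℝ≥0∞ := ∫⁻ ξ, ‖X ξ‖ₑ

/-- `L²` size of a frequency field. [folklore] -/
def L2e (X : ℝ³ → ℂ³) : ℝ≥0∞ := (∫⁻ ξ, ‖X ξ‖ₑ ^ 2) ^ (1 / 2 : ℝ)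

/-- The trilinear bound `‖X₁‖₁ ‖X₂‖₂ ‖X₃‖₂`. [folklore] -/
def tripleBound (X₁ X₂ X₃ : ℝ³ → ℂ³) : ℝ≥0∞ := L1e X₁ * (L2e X₂ * L2e X₃)

/-- `‖X‖₁ < ∞` for `X ∈ L¹ ∩ L²`. [folklore] -/
theorem L1e_lt_top {X : ℝ³ → ℂ³} (hX : FreqIntegrable X) : L1e X < ∞ := hX.1.2

/-- `‖X‖₂ < ∞` for `X ∈ L¹ ∩ L²`. [folklore] -/
theorem L2e_lt_top {X : ℝ³ → ℂ³} (hX : FreqIntegrable X) : L2e X < ∞ := by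
  have h := hX.2.eLpNorm_lt_top
  rw [eLpNorm_eq_lintegral_rpow_enorm_toReal two_ne_zero ENNReal.ofNat_ne_top] at h
  unfold L2e
  convert h using 2
  · refine lintegral_congr fun ξ => ?_
    rw [show (2 : ℝ≥0∞).toReal = ((2 : ℕ) : ℝ) by norm_num, ENNReal.rpow_natCast]
  · norm_num

/-- The trilinear bound is finite for `Xⱼ ∈ L¹ ∩ L²`. [folklore] -/
theorem tripleBound_lt_top {X₁ X₂ X₃ : ℝ³ → ℂ³} (h₁ : FreqIntegrable X₁) (h₂ : FreqIntegrable X₂)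
    (h₃ : FreqIntegrable X₃) : tripleBound X₁ X₂ X₃ < ∞ :=
  ENNReal.mul_lt_top (L1e_lt_top h₁) (ENNReal.mul_lt_top (L2e_lt_top h₂) (L2e_lt_top h₃))

/-- **`∫∫ |f(ξ₁)| |g(ξ₂)| |h(-ξ₁-ξ₂)| ≤ ‖f‖₁ ‖g‖₂ ‖h‖₂`** (Tonelli, Cauchy–Schwarz in `ξ₂`).
[folklore] -/
theorem lintegral_triple_le {f g h : ℝ³ → ℂ³} (hf : AEStronglyMeasurable f volume)
    (hg : AEStronglyMeasurable g volume) (hh : AEStronglyMeasurable h volume) :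
    ∫⁻ p : ℝ³ × ℝ³, ‖f p.1‖ₑ * ‖g p.2‖ₑ * ‖h (-p.1 - p.2)‖ₑ ∂((volume : Measure ℝ³).prod volume) ≤
      tripleBound f g h := by
  have hF : AEMeasurable (fun p : ℝ³ × ℝ³ => ‖f p.1‖ₑ) ((volume : Measure ℝ³).prod volume) :=
    (hf.comp_quasiMeasurePreserving Measure.quasiMeasurePreserving_fst).enorm
  have hG : AEMeasurable (fun p : ℝ³ × ℝ³ => ‖g p.2‖ₑ) ((volume : Measure ℝ³).prod volume) :=
    (hg.comp_quasiMeasurePreserving Measure.quasiMeasurePreserving_snd).enorm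
  have hH : AEMeasurable (fun p : ℝ³ × ℝ³ => ‖h (-p.1 - p.2)‖ₑ) ((volume : Measure ℝ³).prod volume) :=
    (hh.comp_quasiMeasurePreserving quasiMeasurePreserving_neg_fst_sub_snd).enorm
  have hm : AEMeasurable (fun p : ℝ³ × ℝ³ => ‖f p.1‖ₑ * ‖g p.2‖ₑ * ‖h (-p.1 - p.2)‖ₑ)
      ((volume : Measure ℝ³).prod volume) := (hF.mul hG).mul hH
  rw [lintegral_prod _ hm]
  calc ∫⁻ ξ₁, ∫⁻ ξ₂, ‖f ξ₁‖ₑ * ‖g ξ₂‖ₑ * ‖h (-ξ₁ - ξ₂)‖ₑ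
      = ∫⁻ ξ₁, ‖f ξ₁‖ₑ * ∫⁻ ξ₂, ‖g ξ₂‖ₑ * ‖h (-ξ₁ - ξ₂)‖ₑ := by
        refine lintegral_congr fun ξ₁ => ?_
        rw [← lintegral_const_mul' _ _ enorm_ne_top]
        simp only [mul_assoc]
    _ ≤ ∫⁻ ξ₁, ‖f ξ₁‖ₑ * (L2e g * L2e h) := by
        refine lintegral_mono fun ξ₁ => mul_le_mul' le_rfl ?_
        exact lintegral_mul_enorm_comp_sub_le hg.enorm hh (-ξ₁)
    _ = tripleBound f g h := lintegral_mul_const'' _ hf.enorm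

/-- Rotations preserve lower Lebesgue integrals (`Rot_R` is measure preserving). [folklore] -/
theorem lintegral_enorm_comp_symm (T : ℝ³ ≃ₗᵢ[ℝ] ℝ³) (F : ℝ³ → ℝ≥0∞) :
    ∫⁻ ξ, F (T.symm ξ) = ∫⁻ ξ, F ξ :=
  T.symm.measurePreserving.lintegral_comp_emb T.symm.toHomeomorph.measurableEmbedding F

omit [MeasurableSpace A] in
/-- The rotated version: `∫∫ |X₁(A₀⁻¹ξ₁)| |X₂(A₁⁻¹ξ₂)| |X₃(A₂⁻¹ξ₃)| ≤ ‖X₁‖₁ ‖X₂‖₂ ‖X₃‖₂`.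
[folklore] -/
theorem lintegral_normProd_le {X₁ X₂ X₃ : ℝ³ → ℂ³}
    (hX₁ : AEStronglyMeasurable X₁ volume) (hX₂ : AEStronglyMeasurable X₂ volume)
    (hX₃ : AEStronglyMeasurable X₃ volume) (a : A) :
    ∫⁻ p : ℝ³ × ℝ³, ‖normProd S X₁ X₂ X₃ a p‖ₑ ∂((volume : Measure ℝ³).prod volume) ≤
      tripleBound X₁ X₂ X₃ := by
  have q0 := (S 0 a).symm.measurePreserving.quasiMeasurePreserving
  have q1 := (S 1 a).symm.measurePreserving.quasiMeasurePreserving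
  have q2 := (S 2 a).symm.measurePreserving.quasiMeasurePreserving
  have h := lintegral_triple_le (hX₁.comp_quasiMeasurePreserving q0)
    (hX₂.comp_quasiMeasurePreserving q1) (hX₃.comp_quasiMeasurePreserving q2)
  have e : ∀ p : ℝ³ × ℝ³, ‖normProd S X₁ X₂ X₃ a p‖ₑ =
      ‖(X₁ ∘ (S 0 a).symm) p.1‖ₑ * ‖(X₂ ∘ (S 1 a).symm) p.2‖ₑ *
        ‖(X₃ ∘ (S 2 a).symm) (-p.1 - p.2)‖ₑ := fun p => by
    unfold normProd
    rw [Real.enorm_eq_ofReal (by positivity), ENNReal.ofReal_mul (by positivity),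
      ENNReal.ofReal_mul (by positivity), ofReal_norm, ofReal_norm, ofReal_norm]
    rfl
  simp_rw [e]
  refine h.trans (le_of_eq ?_)
  unfold tripleBound L1e L2e
  simp only [Function.comp_apply]
  rw [lintegral_enorm_comp_symm (S 0 a) (fun ξ => ‖X₁ ξ‖ₑ),
    lintegral_enorm_comp_symm (S 1 a) (fun ξ => ‖X₂ ξ‖ₑ ^ 2),
    lintegral_enorm_comp_symm (S 2 a) (fun ξ => ‖X₃ ξ‖ₑ ^ 2)]

end Measurability


/-! ### Fixed-parameter measurability and integrability on `ℝ⁶` -/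

section Fixed

variable (T : Fin 3 → (ℝ³ ≃ₗᵢ[ℝ] ℝ³))

/-- `LamRot` at a fixed parameter is a.e. strongly measurable on `ℝ⁶`. [folklore] -/
theorem aestronglyMeasurable_LamRot_fixed {X₁ X₂ X₃ : ℝ³ → ℂ³}
    (hX₁ : AEStronglyMeasurable X₁ volume) (hX₂ : AEStronglyMeasurable X₂ volume)
    (hX₃ : AEStronglyMeasurable X₃ volume) :
    AEStronglyMeasurable (fun p : ℝ³ × ℝ³ => LamRot (fun j (_ : Unit) => T j) X₁ X₂ X₃ () p)
      ((volume : Measure ℝ³).prod volume) := by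
  have h := aestronglyMeasurable_LamRot (S := fun j (_ : Unit) => T j) (Measure.dirac ())
    (fun j x => measurable_const) hX₁ hX₂ hX₃
  have hmp : MeasurePreserving (fun p : ℝ³ × ℝ³ => ((), p)) ((volume : Measure ℝ³).prod volume)
      ((Measure.dirac ()).prod ((volume : Measure ℝ³).prod volume)) := by
    refine ⟨measurable_const.prodMk measurable_id, ?_⟩
    rw [← Measure.dirac_prod (x := ()) (ν := (volume : Measure ℝ³).prod volume)]
  have h2 := h.comp_measurePreserving hmp
  exact h2

/-- `normProd` at a fixed parameter is a.e. strongly measurable on `ℝ⁶`. [folklore] -/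
theorem aestronglyMeasurable_normProd_fixed {X₁ X₂ X₃ : ℝ³ → ℂ³}
    (hX₁ : AEStronglyMeasurable X₁ volume) (hX₂ : AEStronglyMeasurable X₂ volume)
    (hX₃ : AEStronglyMeasurable X₃ volume) :
    AEStronglyMeasurable (fun p : ℝ³ × ℝ³ => normProd (fun j (_ : Unit) => T j) X₁ X₂ X₃ () p)
      ((volume : Measure ℝ³).prod volume) := by
  have h := aestronglyMeasurable_normProd (S := fun j (_ : Unit) => T j) (Measure.dirac ())
    (fun j x => measurable_const) hX₁ hX₂ hX₃
  have hmp : MeasurePreserving (fun p : ℝ³ × ℝ³ => ((), p)) ((volume : Measure ℝ³).prod volume)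
      ((Measure.dirac ()).prod ((volume : Measure ℝ³).prod volume)) := by
    refine ⟨measurable_const.prodMk measurable_id, ?_⟩
    rw [← Measure.dirac_prod (x := ()) (ν := (volume : Measure ℝ³).prod volume)]
  have h2 := h.comp_measurePreserving hmp
  exact h2

/-- `normProd` at a fixed parameter is integrable on `ℝ⁶` for `Xⱼ ∈ L¹ ∩ L²`. [folklore] -/
theorem integrable_normProd_fixed {X₁ X₂ X₃ : ℝ³ → ℂ³} (h₁ : FreqIntegrable X₁)
    (h₂ : FreqIntegrable X₂) (h₃ : FreqIntegrable X₃) :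
    Integrable (fun p : ℝ³ × ℝ³ => normProd (fun j (_ : Unit) => T j) X₁ X₂ X₃ () p)
      ((volume : Measure ℝ³).prod volume) := by
  refine ⟨aestronglyMeasurable_normProd_fixed T h₁.1.1 h₂.1.1 h₃.1.1, ?_⟩
  exact lt_of_le_of_lt (lintegral_normProd_le (S := fun j (_ : Unit) => T j) h₁.1.1 h₂.1.1 h₃.1.1 ())
    (tripleBound_lt_top h₁ h₂ h₃)

end Fixed

/-! ### The phase of a complex number -/

/-- `z / |z|` (and `0` at `0`). [folklore] -/
def phase (z : ℂ) : ℂ := ((‖z‖⁻¹ : ℝ) : ℂ) * z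

/-- `|z/|z|| ≤ 1`. [folklore] -/
theorem norm_phase_le_one (z : ℂ) : ‖phase z‖ ≤ 1 := by
  unfold phase
  rw [norm_mul, Complex.norm_real, Real.norm_eq_abs, abs_inv, abs_norm]
  by_cases hz : ‖z‖ = 0
  · rw [hz]
    simp
  · rw [inv_mul_cancel₀ hz]

/-- `|z| · (z/|z|) = z`. [folklore] -/
theorem ofReal_norm_mul_phase (z : ℂ) : ((‖z‖ : ℝ) : ℂ) * phase z = z := by
  unfold phase
  by_cases hz : z = 0
  · simp [hz]
  · rw [← mul_assoc, ← Complex.ofReal_mul, mul_inv_cancel₀ (norm_ne_zero_iff.2 hz),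
      Complex.ofReal_one, one_mul]

/-- The phase is measurable. [folklore] -/
theorem measurable_phase : Measurable phase :=
  (Complex.measurable_ofReal.comp measurable_norm.inv).mul measurable_id

/-! ### The flattened weight, its Fourier transform, and the weighted measure -/

section Weight

variable {d : ℕ} (F : (Fin d → ℝ³) × (ℝ³ × ℝ³) → ℂ)

/-- The joint weight pulled back to the flattened Euclidean space.
[cite: Tao2016AveragedNS, §3.6 p. 18] -/
def Gfun (v : Wsp d) : ℂ := F (splitCLE d v)

/-- Its Fourier transform `f̂` (Tao's `f`, up to the sign convention of the expansion).
[cite: Tao2016AveragedNS, §3.6 p. 18] -/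
def Ghat : Wsp d → ℂ := 𝓕 (Gfun F)

/-- Haar (Lebesgue) measure on the flattened space weighted by `|f̂|` ("`μ` being Haar measure
weighted by `|f|`", Tao p. 18). [cite: Tao2016AveragedNS, §3.6 p. 18] -/
def nu : Measure (Wsp d) := volume.withDensity fun v => ‖Ghat F v‖ₑ

variable {F}

section Hyp

variable (hF : ContDiff ℝ ((⊤ : ℕ∞) : WithTop ℕ∞) F) (hFc : HasCompactSupport F)

/-- The pulled-back weight is smooth. [folklore] -/
theorem contDiff_Gfun (hF : ContDiff ℝ ((⊤ : ℕ∞) : WithTop ℕ∞) F) :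
    ContDiff ℝ ((⊤ : ℕ∞) : WithTop ℕ∞) (Gfun F) :=
  hF.comp (splitCLE d).contDiff

/-- The pulled-back weight has compact support. [folklore] -/
theorem hasCompactSupport_Gfun (hFc : HasCompactSupport F) : HasCompactSupport (Gfun F) :=
  hFc.comp_homeomorph (splitCLE d).toHomeomorph

/-- The pulled-back weight as a Schwartz function. [cite: Tao2016AveragedNS, §3.6 p. 18] -/
def GS (hF : ContDiff ℝ ((⊤ : ℕ∞) : WithTop ℕ∞) F) (hFc : HasCompactSupport F) : 𝓢(Wsp d, ℂ) :=
  (hasCompactSupport_Gfun hFc).toSchwartzMap (contDiff_Gfun hF)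

/-- The Schwartz function `GS` is the pulled-back weight pointwise. [folklore] -/
theorem GS_coe : ⇑(GS hF hFc) = Gfun F := rfl

/-- `f̂` as a Schwartz function. [cite: Tao2016AveragedNS, §3.6 p. 18] -/
def GhatS (hF : ContDiff ℝ ((⊤ : ℕ∞) : WithTop ℕ∞) F) (hFc : HasCompactSupport F) : 𝓢(Wsp d, ℂ) :=
  𝓕 (GS hF hFc)

/-- The Schwartz function `GhatS` is `f̂` pointwise. [folklore] -/
theorem GhatS_coe : ⇑(GhatS hF hFc) = Ghat F := by
  rw [GhatS, SchwartzMap.fourier_coe, GS_coe]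
  rfl

include hF hFc in
/-- `f̂` is continuous. [folklore] -/
theorem continuous_Ghat : Continuous (Ghat F) := by
  rw [← GhatS_coe hF hFc]
  exact (GhatS hF hFc).continuous

include hF hFc in
/-- `f̂` is integrable. [folklore] -/
theorem integrable_Ghat : Integrable (Ghat F) := by
  rw [← GhatS_coe hF hFc]
  exact (GhatS hF hFc).integrable

include hF hFc in
/-- `‖v‖ᵏ |f̂(v)|` is integrable ("`f` … rapidly decreasing", Tao p. 18).
[cite: Tao2016AveragedNS, §3.6 p. 18] -/
theorem integrable_pow_mul_Ghat (k : ℕ) : Integrable fun v : Wsp d => ‖v‖ ^ k * ‖Ghat F v‖ := by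
  rw [← GhatS_coe hF hFc]
  exact (GhatS hF hFc).integrable_pow_mul volume k

include hF hFc in
/-- `(1 + ‖v‖)ᵏ |f̂(v)|` is integrable ("`f` … rapidly decreasing", Tao p. 18).
[cite: Tao2016AveragedNS, §3.6 p. 18] -/
theorem integrable_one_add_norm_pow_mul_Ghat (k : ℕ) :
    Integrable fun v : Wsp d => (1 + ‖v‖) ^ k * ‖Ghat F v‖ := by
  have h := ((integrable_Ghat hF hFc).norm.add (integrable_pow_mul_Ghat hF hFc k)).const_mul
    (2 ^ (k - 1))
  refine h.mono' ?_ (Eventually.of_forall fun v => ?_)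
  · exact (((continuous_const.add continuous_norm).pow k).mul
      (continuous_Ghat hF hFc).norm).aestronglyMeasurable
  · rw [Real.norm_eq_abs, abs_of_nonneg (by positivity)]
    have h1 : (1 + ‖v‖) ^ k ≤ 2 ^ (k - 1) * (1 ^ k + ‖v‖ ^ k) := add_pow_le zero_le_one (norm_nonneg _) k
    rw [one_pow] at h1
    calc (1 + ‖v‖) ^ k * ‖Ghat F v‖ ≤ 2 ^ (k - 1) * (1 + ‖v‖ ^ k) * ‖Ghat F v‖ :=
          mul_le_mul_of_nonneg_right h1 (norm_nonneg _)
      _ = 2 ^ (k - 1) * (‖Ghat F v‖ + ‖v‖ ^ k * ‖Ghat F v‖) := by ring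

include hF hFc in
/-- **Fourier inversion for the joint weight**: `F(ω, ξ₁, ξ₂) = ∫ f̂(v) e^{2πi ⟨v, (ω,ξ₁,ξ₂)⟩} dv`.
[cite: Tao2016AveragedNS, §3.6 p. 18] -/
theorem fourier_inversion_F (q : (Fin d → ℝ³) × (ℝ³ × ℝ³)) :
    ∫ v : Wsp d, (𝐞 ⟪v, glue d q⟫ : ℂ) * Ghat F v = F q := by
  have hint : Integrable (Gfun F) := by
    have h := (GS hF hFc).integrable (μ := volume)
    rwa [GS_coe] at h
  have hinv : 𝓕⁻ (Ghat F) = Gfun F := by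
    unfold Ghat
    exact (contDiff_Gfun hF).continuous.fourierInv_fourier_eq hint (integrable_Ghat hF hFc)
  have h := congrFun hinv (glue d q)
  rw [Real.fourierInv_eq] at h
  simp only [Circle.smul_def, smul_eq_mul] at h
  rw [h, Gfun, ← splitCLE_symm_apply, ContinuousLinearEquiv.apply_symm_apply]

include hF hFc in
/-- `∫ |f̂| < ∞`. [folklore] -/
theorem lintegral_enorm_Ghat_lt_top : ∫⁻ v, ‖Ghat F v‖ₑ < ∞ := (integrable_Ghat hF hFc).2

include hF hFc in
/-- `ν = |f̂| dv` is a finite measure ("a finite measure space `(Ω, μ)`", Def. 3.4).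
[cite: Tao2016AveragedNS, Def. 3.4 and §3.6 p. 18] -/
theorem isFiniteMeasure_nu : IsFiniteMeasure (nu F) :=
  isFiniteMeasure_withDensity (lintegral_enorm_Ghat_lt_top hF hFc).ne

include hF hFc in
/-- `|f̂|` is measurable. [folklore] -/
theorem measurable_enorm_Ghat : Measurable fun v : Wsp d => ‖Ghat F v‖ₑ :=
  (continuous_Ghat hF hFc).measurable.enorm

include hF hFc in
/-- Integration against `ν = |f̂| dv`. [folklore] -/
theorem integral_nu (g : Wsp d → ℂ) : ∫ v, g v ∂(nu F) = ∫ v, ((‖Ghat F v‖ : ℝ) : ℂ) * g v := by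
  unfold nu
  rw [integral_withDensity_eq_integral_toReal_smul (measurable_enorm_Ghat hF hFc)
    (Eventually.of_forall fun _ => enorm_lt_top)]
  refine integral_congr_ae (Eventually.of_forall fun v => ?_)
  change (‖Ghat F v‖ₑ).toReal • g v = ((‖Ghat F v‖ : ℝ) : ℂ) * g v
  rw [toReal_enorm, Complex.real_smul]

include hF hFc in
/-- Lower integration against `ν = |f̂| dv`. [folklore] -/
theorem lintegral_nu {g : Wsp d → ℝ≥0∞} (hg : Measurable g) :
    ∫⁻ v, g v ∂(nu F) = ∫⁻ v, ‖Ghat F v‖ₑ * g v := by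
  unfold nu
  rw [lintegral_withDensity_eq_lintegral_mul _ (measurable_enorm_Ghat hF hFc) hg]
  rfl

end Hyp

/-- A radius bounding the frequency support of the joint weight. [folklore] -/
theorem exists_radius (hFc : HasCompactSupport F) : ∃ r : ℝ, tsupport F ⊆ closedBall 0 r :=
  hFc.isCompact.isBounded.subset_closedBall 0

/-- The radius. [cite: Tao2016AveragedNS, §3.6 p. 18] -/
def Rad (hFc : HasCompactSupport F) : ℝ := Classical.choose (exists_radius hFc)

/-- The support of the joint weight lies in the closed ball of radius `Rad`. [folklore] -/
theorem tsupport_subset_Rad (hFc : HasCompactSupport F) : tsupport F ⊆ closedBall 0 (Rad hFc) :=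
  Classical.choose_spec (exists_radius hFc)

/-- On the support of `F`, both frequencies have norm at most `Rad`.
[cite: Tao2016AveragedNS, §3.6 p. 18] -/
theorem norm_le_Rad_of_ne_zero (hFc : HasCompactSupport F) {q : (Fin d → ℝ³) × (ℝ³ × ℝ³)}
    (hq : F q ≠ 0) :
    ‖q.2.1‖ ≤ Rad hFc ∧ ‖q.2.2‖ ≤ Rad hFc := by
  have h : q ∈ closedBall (0 : (Fin d → ℝ³) × (ℝ³ × ℝ³)) (Rad hFc) :=
    tsupport_subset_Rad hFc (subset_tsupport F (Function.mem_support.2 hq))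
  rw [mem_closedBall, dist_zero_right] at h
  exact ⟨(norm_fst_le q.2).trans ((norm_snd_le q).trans h),
    (norm_snd_le q.2).trans ((norm_snd_le q).trans h)⟩

end Weight

/-! ### The kernel `φ η · e^{2πi x₁·ξ₁} χ(ξ₁) · e^{2πi x₂·ξ₂} χ(ξ₂)` -/

section Kernel

variable (d : ℕ) (R ε₀ : ℝ)

/-- The single-scale weight as a complex number.
[cite: Tao2016AveragedNS, §3.4 (3.9) and §3.5 (3.13)] -/
def wt (ε₀ : ℝ) (p : ℝ³ × ℝ³) : ℂ := ((singleScaleWeight ε₀ p : ℝ) : ℂ)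

/-- `|φ η| ≤ 1` (both cut-offs take values in `[0,1]`). [cite: Tao2016AveragedNS, §3.3 p. 16] -/
theorem norm_wt_le_one (p : ℝ³ × ℝ³) : ‖wt ε₀ p‖ ≤ 1 := by
  unfold wt singleScaleWeight eta
  rw [Complex.norm_real, Real.norm_eq_abs, abs_mul, abs_mul]
  have h1 := freqCutoff_nonneg
  have h2 := freqCutoff_le_one
  refine mul_le_one₀ ?_ (by positivity) (mul_le_one₀ ?_ (abs_nonneg _) ?_) <;>
    · rw [abs_of_nonneg (h1 _)]
      exact h2 _

/-- The cut-off `φ` is measurable. [folklore] -/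
theorem measurable_freqCutoff : Measurable freqCutoff := contDiff_freqCutoff (n := 0).continuous.measurable

/-- The comparability weight `η` is measurable. [folklore] -/
theorem measurable_eta : Measurable fun q : ℝ × ℝ × ℝ => eta ε₀ q.1 q.2.1 q.2.2 := by
  unfold eta
  exact (measurable_freqCutoff.comp (((measurable_snd.fst.div measurable_fst).sub_const _).div_const _)).mul
    (measurable_freqCutoff.comp (((measurable_snd.snd.div measurable_fst).sub_const _).div_const _))

/-- `(ξ₁, ξ₂) ↦ (|ξ₁|, |ξ₂|, |ξ₃|)` is measurable. [folklore] -/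
theorem measurable_norms : Measurable fun p : ℝ³ × ℝ³ => (‖p.1‖, (‖p.2‖, ‖-p.1 - p.2‖)) :=
  measurable_fst.norm.prodMk (measurable_snd.norm.prodMk measurable_neg_fst_sub_snd.norm)

/-- `η(|ξ₁|, |ξ₂|, |ξ₃|)` is measurable (composition form). [folklore] -/
theorem measurable_eta_norms : Measurable ((fun q : ℝ × ℝ × ℝ => eta ε₀ q.1 q.2.1 q.2.2) ∘
    fun p : ℝ³ × ℝ³ => (‖p.1‖, (‖p.2‖, ‖-p.1 - p.2‖))) :=
  (measurable_eta ε₀).comp measurable_norms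

/-- `η(|ξ₁|, |ξ₂|, |ξ₃|)` is measurable. [folklore] -/
theorem measurable_eta_norms' : Measurable fun p : ℝ³ × ℝ³ => eta ε₀ ‖p.1‖ ‖p.2‖ ‖-p.1 - p.2‖ :=
  measurable_eta_norms ε₀

/-- `φ(|ξ₁ - ξ₁⁰|/ε₀²)` is measurable. [folklore] -/
theorem measurable_phi_fst : Measurable fun p : ℝ³ × ℝ³ => freqCutoff (‖p.1 - xi0 0‖ / ε₀ ^ 2) :=
  measurable_freqCutoff.comp ((measurable_fst.sub_const _).norm.div_const _)

/-- The single-scale weight `φ η` is measurable. [cite: Tao2016AveragedNS, §3.4 (3.9)] -/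
theorem measurable_singleScaleWeight : Measurable (singleScaleWeight ε₀) :=
  (measurable_phi_fst ε₀).mul (measurable_eta_norms' ε₀)

/-- The single-scale weight (complex-valued) is measurable. [folklore] -/
theorem measurable_wt : Measurable (wt ε₀) :=
  Complex.measurable_ofReal.comp (measurable_singleScaleWeight ε₀)

/-- The kernel `K(v; ξ₁, ξ₂) = φ η (ξ₁,ξ₂) · e^{2πi x₁(v)·ξ₁} χ(ξ₁) · e^{2πi x₂(v)·ξ₂} χ(ξ₂)`.
[cite: Tao2016AveragedNS, §3.6 p. 18] -/
def K (v : Wsp d) (p : ℝ³ × ℝ³) : ℂ := wt ε₀ p * (pw R (x1Part d v) p.1 * pw R (x2Part d v) p.2)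

/-- `(v, ξ₁, ξ₂) ↦ e^{2πi x₁(v)·ξ₁} χ(ξ₁)` is continuous. [folklore] -/
theorem continuous_pw_x1Part : Continuous fun q : Wsp d × (ℝ³ × ℝ³) => pw R (x1Part d q.1) q.2.1 := by
  have h1 : Continuous fun q : Wsp d × (ℝ³ × ℝ³) => (x1Part d q.1, q.2.1) :=
    ((continuous_x1Part d).comp continuous_fst).prodMk (continuous_fst.comp continuous_snd)
  have h2 := (continuous_pw_uncurry R).comp h1
  exact h2

/-- `(v, ξ₁, ξ₂) ↦ e^{2πi x₂(v)·ξ₂} χ(ξ₂)` is continuous. [folklore] -/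
theorem continuous_pw_x2Part : Continuous fun q : Wsp d × (ℝ³ × ℝ³) => pw R (x2Part d q.1) q.2.2 := by
  have h1 : Continuous fun q : Wsp d × (ℝ³ × ℝ³) => (x2Part d q.1, q.2.2) :=
    ((continuous_x2Part d).comp continuous_fst).prodMk (continuous_snd.comp continuous_snd)
  have h2 := (continuous_pw_uncurry R).comp h1
  exact h2

/-- The kernel is jointly measurable. [folklore] -/
theorem measurable_K : Measurable fun q : Wsp d × (ℝ³ × ℝ³) => K d R ε₀ q.1 q.2 := by
  have h0 : Measurable fun q : Wsp d × (ℝ³ × ℝ³) => wt ε₀ q.2 := (measurable_wt ε₀).comp measurable_snd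
  have h1 := (continuous_pw_x1Part d R).measurable
  have h2 := (continuous_pw_x2Part d R).measurable
  have h3 := h0.mul (h1.mul h2)
  exact h3

/-- `χ(ξ) |ξ| ≤ max R 0 + 2`: the bump localises the frequency. [folklore] -/
theorem chi_mul_norm_le (ξ : ℝ³) : chi R ξ * ‖ξ‖ ≤ max R 0 + 2 := by
  by_cases h : max R 0 + 2 ≤ ‖ξ‖
  · rw [chi_eq_zero h, zero_mul]
    positivity
  · calc chi R ξ * ‖ξ‖ ≤ 1 * ‖ξ‖ := mul_le_mul_of_nonneg_right (chi_le_one R ξ) (norm_nonneg _)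
      _ ≤ max R 0 + 2 := by rw [one_mul]; exact (not_le.mp h).le

/-- `|e^{2πi x·ξ} χ(ξ)| ≤ χ(ξ)`. [folklore] -/
theorem norm_pw_le_chi (x ξ : ℝ³) : ‖pw R x ξ‖ ≤ chi R ξ := by
  rw [pw, norm_mul, Circle.norm_coe, one_mul, chiC, Complex.norm_real, Real.norm_eq_abs,
    abs_of_nonneg (chi_nonneg R ξ)]

/-- `|K(v; ξ₁, ξ₂)| (|ξ₁| + |ξ₂|) ≤ 2 (R⁺ + 2)`: the kernel localises both frequencies.
[cite: Tao2016AveragedNS, §3.6 p. 18] -/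
theorem norm_K_mul_le (v : Wsp d) (p : ℝ³ × ℝ³) :
    ‖K d R ε₀ v p‖ * (‖p.1‖ + ‖p.2‖) ≤ 2 * (max R 0 + 2) := by
  have hK : ‖K d R ε₀ v p‖ ≤ chi R p.1 * chi R p.2 := by
    unfold K
    rw [norm_mul, norm_mul]
    calc ‖wt ε₀ p‖ * (‖pw R (x1Part d v) p.1‖ * ‖pw R (x2Part d v) p.2‖)
        ≤ 1 * (chi R p.1 * chi R p.2) :=
          mul_le_mul (norm_wt_le_one ε₀ p) (mul_le_mul (norm_pw_le_chi R _ _) (norm_pw_le_chi R _ _)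
            (norm_nonneg _) (chi_nonneg R _)) (by positivity) zero_le_one
      _ = chi R p.1 * chi R p.2 := one_mul _
  have h1 := chi_mul_norm_le R p.1
  have h2 := chi_mul_norm_le R p.2
  have c1 := chi_le_one R p.1
  have c2 := chi_le_one R p.2
  have n1 := chi_nonneg R p.1
  have n2 := chi_nonneg R p.2
  calc ‖K d R ε₀ v p‖ * (‖p.1‖ + ‖p.2‖) ≤ chi R p.1 * chi R p.2 * (‖p.1‖ + ‖p.2‖) :=
        mul_le_mul_of_nonneg_right hK (by positivity)
    _ = chi R p.2 * (chi R p.1 * ‖p.1‖) + chi R p.1 * (chi R p.2 * ‖p.2‖) := by ring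
    _ ≤ 1 * (max R 0 + 2) + 1 * (max R 0 + 2) := by
        gcongr
    _ = 2 * (max R 0 + 2) := by ring

/-- `|K| ≤ 1`. [folklore] -/
theorem norm_K_le_one (v : Wsp d) (p : ℝ³ × ℝ³) : ‖K d R ε₀ v p‖ ≤ 1 := by
  unfold K
  rw [norm_mul, norm_mul]
  calc ‖wt ε₀ p‖ * (‖pw R (x1Part d v) p.1‖ * ‖pw R (x2Part d v) p.2‖) ≤ 1 * (1 * 1) :=
        mul_le_mul (norm_wt_le_one ε₀ p) (mul_le_mul (norm_pw_le_one R _ _) (norm_pw_le_one R _ _)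
          (norm_nonneg _) zero_le_one) (by positivity) zero_le_one
    _ = 1 := by ring

/-- **The pointwise domination** `|K(v; ξ₁, ξ₂) Λ(Y₁, Y₂, Y₃)| ≤ 2 (R⁺ + 2) |X₁| |X₂| |X₃|`.
[cite: Tao2016AveragedNS, §3.6 p. 18] -/
theorem norm_K_mul_LamRot_le {A : Type*} (S : Fin 3 → A → (ℝ³ ≃ₗᵢ[ℝ] ℝ³)) (X₁ X₂ X₃ : ℝ³ → ℂ³)
    (a : A) (v : Wsp d) (p : ℝ³ × ℝ³) :
    ‖K d R ε₀ v p * LamRot S X₁ X₂ X₃ a p‖ ≤ 2 * (max R 0 + 2) * normProd S X₁ X₂ X₃ a p := by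
  rw [norm_mul]
  have hn := normProd_nonneg S X₁ X₂ X₃ a p
  calc ‖K d R ε₀ v p‖ * ‖LamRot S X₁ X₂ X₃ a p‖
      ≤ ‖K d R ε₀ v p‖ * ((‖p.1‖ + ‖p.2‖) * normProd S X₁ X₂ X₃ a p) :=
        mul_le_mul_of_nonneg_left (norm_LamRot_le S X₁ X₂ X₃ a p) (norm_nonneg _)
    _ = ‖K d R ε₀ v p‖ * (‖p.1‖ + ‖p.2‖) * normProd S X₁ X₂ X₃ a p := by ring
    _ ≤ 2 * (max R 0 + 2) * normProd S X₁ X₂ X₃ a p :=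
        mul_le_mul_of_nonneg_right (norm_K_mul_le d R ε₀ v p) hn

end Kernel


/-! ### Fixed-parameter versions at a point of a general parameter space -/

section At

variable {A : Type*} (S : Fin 3 → A → (ℝ³ ≃ₗᵢ[ℝ] ℝ³)) (a : A)

/-- `Λ` of the rotated fields at a fixed parameter is a.e. strongly measurable on `ℝ⁶`. [folklore] -/
theorem aestronglyMeasurable_LamRot_at {X₁ X₂ X₃ : ℝ³ → ℂ³}
    (hX₁ : AEStronglyMeasurable X₁ volume) (hX₂ : AEStronglyMeasurable X₂ volume)
    (hX₃ : AEStronglyMeasurable X₃ volume) :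
    AEStronglyMeasurable (fun p : ℝ³ × ℝ³ => LamRot S X₁ X₂ X₃ a p)
      ((volume : Measure ℝ³).prod volume) := by
  have h := aestronglyMeasurable_LamRot_fixed (fun j => S j a) hX₁ hX₂ hX₃
  exact h

/-- `normProd` at a fixed parameter is a.e. strongly measurable on `ℝ⁶`. [folklore] -/
theorem aestronglyMeasurable_normProd_at {X₁ X₂ X₃ : ℝ³ → ℂ³}
    (hX₁ : AEStronglyMeasurable X₁ volume) (hX₂ : AEStronglyMeasurable X₂ volume)
    (hX₃ : AEStronglyMeasurable X₃ volume) :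
    AEStronglyMeasurable (fun p : ℝ³ × ℝ³ => normProd S X₁ X₂ X₃ a p)
      ((volume : Measure ℝ³).prod volume) := by
  have h := aestronglyMeasurable_normProd_fixed (fun j => S j a) hX₁ hX₂ hX₃
  exact h

/-- `normProd` at a fixed parameter is integrable on `ℝ⁶` for `Xⱼ ∈ L¹ ∩ L²`. [folklore] -/
theorem integrable_normProd_at {X₁ X₂ X₃ : ℝ³ → ℂ³} (h₁ : FreqIntegrable X₁)
    (h₂ : FreqIntegrable X₂) (h₃ : FreqIntegrable X₃) :
    Integrable (fun p : ℝ³ × ℝ³ => normProd S X₁ X₂ X₃ a p) ((volume : Measure ℝ³).prod volume) := by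
  have h := integrable_normProd_fixed (fun j => S j a) h₁ h₂ h₃
  exact h

end At

/-- `Λ` is trilinear: scalars pull out of all three vector slots. [cite: Tao2016AveragedNS, (1.4)] -/
theorem Λ_smul_smul_smul (ξ₁ ξ₂ : ℝ³) (a b c : ℂ) (X₁ X₂ X₃ : ℂ³) :
    Λ ξ₁ ξ₂ (a • X₁) (b • X₂) (c • X₃) = a * b * c * Λ ξ₁ ξ₂ X₁ X₂ X₃ := by
  simp only [Λ, cdot, PiLp.smul_apply, smul_eq_mul, Fin.sum_univ_three]
  ring

/-! ### The complex averaging datum of the plane-wave synthesis -/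

section Datum

variable {d : ℕ} (μ₀ : Measure (Fin d → ℝ³)) {E : Fin 3 → (Fin d → ℝ³) → (ℝ³ ≃ₗᵢ[ℝ] ℝ³)}
  {F : (Fin d → ℝ³) × (ℝ³ × ℝ³) → ℂ}

/-- The unimodular factor `(f̂/|f̂|)(v) · e^{2πi φ(v, ω)}` absorbed into the first symbol.
[cite: Tao2016AveragedNS, §3.6 p. 18] -/
def c0 (F : (Fin d → ℝ³) × (ℝ³ × ℝ³) → ℂ) (θ : (Fin d → ℝ³) × Wsp d) : ℂ :=
  phase (Ghat F θ.2) * ((𝐞 (omegaPhase d θ.2 θ.1) : Circle) : ℂ)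

/-- The absorbed factor is bounded by one (`F := f/|f|`, Tao p. 18).
[cite: Tao2016AveragedNS, §3.6 p. 18] -/
theorem norm_c0_le_one (θ : (Fin d → ℝ³) × Wsp d) : ‖c0 F θ‖ ≤ 1 := by
  unfold c0
  rw [norm_mul, Circle.norm_coe, mul_one]
  exact norm_phase_le_one _

/-- `θ = (ω, v) ↦ e^{2πi φ(v, ω)}` is continuous. [folklore] -/
theorem continuous_omegaCharacter :
    Continuous fun θ : (Fin d → ℝ³) × Wsp d => ((𝐞 (omegaPhase d θ.2 θ.1) : Circle) : ℂ) := by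
  have h1 : Continuous fun θ : (Fin d → ℝ³) × Wsp d => omegaPhase d θ.2 θ.1 :=
    (continuous_omegaPhase d).comp (continuous_snd.prodMk continuous_fst)
  have h2 := continuous_induced_dom.comp' (Real.continuous_fourierChar.comp h1)
  exact h2

/-- The absorbed factor is measurable in `θ`. [folklore] -/
theorem measurable_c0 (hF : ContDiff ℝ ((⊤ : ℕ∞) : WithTop ℕ∞) F) (hFc : HasCompactSupport F) :
    Measurable (c0 (d := d) F) := by
  have h1 : Measurable fun θ : (Fin d → ℝ³) × Wsp d => phase (Ghat F θ.2) :=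
    measurable_phase.comp ((continuous_Ghat hF hFc).measurable.comp measurable_snd)
  have h3 := h1.mul (continuous_omegaCharacter (d := d)).measurable
  exact h3

variable (R : ℝ)

/-- The three random symbols: `m_{1,θ} = c₀(θ) e^{2πi x₁·ξ} χ(ξ)`, `m_{2,θ} = e^{2πi x₂·ξ} χ(ξ)`,
`m_{3,θ} = 1` ("an appropriately rotated version of `mⱼ`, twisted by a plane wave"). [cite: Tao2016AveragedNS, §3.6 p. 18] -/
def symb (R : ℝ) (F : (Fin d → ℝ³) × (ℝ³ × ℝ³) → ℂ) : Fin 3 → ((Fin d → ℝ³) × Wsp d) → ℝ³ → ℂ :=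
  ![fun θ ξ => c0 F θ * pw R (x1Part d θ.2) ξ, fun θ ξ => 1 * pw R (x2Part d θ.2) ξ, fun _ _ => 1]

/-- The first symbol. [cite: Tao2016AveragedNS, §3.6 p. 18] -/
theorem symb_zero : symb R F 0 = fun θ ξ => c0 F θ * pw R (x1Part d θ.2) ξ := rfl

/-- The second symbol. [cite: Tao2016AveragedNS, §3.6 p. 18] -/
theorem symb_one : symb R F 1 = fun θ ξ => 1 * pw R (x2Part d θ.2) ξ := rfl

/-- The third symbol. [cite: Tao2016AveragedNS, §3.6 p. 18] -/
theorem symb_two : symb R F 2 = fun _ _ => 1 := rfl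

/-- Each symbol is a complex Fourier multiplier of order `0` ("`m_{i,·}(D) : Ω → 𝓜₀ ⊗ ℂ`").
[cite: Tao2016AveragedNS, Def. 3.4 and §3.6 p. 18] -/
theorem isComplexSymbol_symb (i : Fin 3) (θ : (Fin d → ℝ³) × Wsp d) :
    IsComplexSymbol (symb R F i θ) := by
  fin_cases i
  · exact isComplexSymbol_const_mul_pw R (x1Part d θ.2) (norm_c0_le_one θ)
  · exact isComplexSymbol_const_mul_pw R (x2Part d θ.2) (c := 1) (by simp)
  · exact isComplexSymbol_const 1

/-- The symbols are measurable in `θ` ("measurable functions … `m_{i,·}(D)`", Def. 3.4).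
[cite: Tao2016AveragedNS, Def. 3.4] -/
theorem measurable_symb_apply (hF : ContDiff ℝ ((⊤ : ℕ∞) : WithTop ℕ∞) F) (hFc : HasCompactSupport F)
    (i : Fin 3) (ξ : ℝ³) : Measurable fun θ : (Fin d → ℝ³) × Wsp d => symb R F i θ ξ := by
  have hp1 : Continuous fun θ : (Fin d → ℝ³) × Wsp d => pw R (x1Part d θ.2) ξ := by
    have h1 : Continuous fun θ : (Fin d → ℝ³) × Wsp d => (x1Part d θ.2, ξ) :=
      ((continuous_x1Part d).comp continuous_snd).prodMk continuous_const
    have h2 := (continuous_pw_uncurry R).comp h1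
    exact h2
  have hp2 : Continuous fun θ : (Fin d → ℝ³) × Wsp d => pw R (x2Part d θ.2) ξ := by
    have h1 : Continuous fun θ : (Fin d → ℝ³) × Wsp d => (x2Part d θ.2, ξ) :=
      ((continuous_x2Part d).comp continuous_snd).prodMk continuous_const
    have h2 := (continuous_pw_uncurry R).comp h1
    exact h2
  fin_cases i
  · have h := (measurable_c0 hF hFc).mul hp1.measurable
    exact h
  · have h := (measurable_const (a := (1 : ℂ))).mul hp2.measurable
    exact h
  · exact measurable_const

/-- `‖m_{1,θ}‖_k ≤ C_k (1 + |v|)ᵏ`. [cite: Tao2016AveragedNS, §3.6 p. 18] -/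
theorem symbolSeminorm_symb_zero_le (k : ℕ) (θ : (Fin d → ℝ³) × Wsp d) :
    symbolSeminorm k (symb R F 0 θ) ≤ ENNReal.ofReal (pwSymbolConst R k * (1 + ‖θ.2‖) ^ k) := by
  refine (symbolSeminorm_const_mul_pw_le R k (x1Part d θ.2) (norm_c0_le_one θ)).trans ?_
  refine ENNReal.ofReal_le_ofReal (mul_le_mul_of_nonneg_left ?_ (pwSymbolConst_nonneg R k))
  exact pow_le_pow_left₀ (by positivity) (by linarith [norm_x1Part_le d θ.2]) k

/-- `‖m_{2,θ}‖_k ≤ C_k (1 + |v|)ᵏ`. [cite: Tao2016AveragedNS, §3.6 p. 18] -/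
theorem symbolSeminorm_symb_one_le (k : ℕ) (θ : (Fin d → ℝ³) × Wsp d) :
    symbolSeminorm k (symb R F 1 θ) ≤ ENNReal.ofReal (pwSymbolConst R k * (1 + ‖θ.2‖) ^ k) := by
  refine (symbolSeminorm_const_mul_pw_le R k (x2Part d θ.2) (c := 1) (by simp)).trans ?_
  refine ENNReal.ofReal_le_ofReal (mul_le_mul_of_nonneg_left ?_ (pwSymbolConst_nonneg R k))
  exact pow_le_pow_left₀ (by positivity) (by linarith [norm_x2Part_le d θ.2]) k

/-- **The integrability conditions (3.5)** for the plane-wave datum: from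
`‖e^{2πi x·ξ} χ(ξ)‖_k ≲ (1+|x|)ᵏ` and the rapid decay of `f̂`. [cite: Tao2016AveragedNS, Def. 3.4 (3.5) and §3.6 p. 18] -/
theorem moment_lt_top [IsFiniteMeasure μ₀] (hF : ContDiff ℝ ((⊤ : ℕ∞) : WithTop ℕ∞) F)
    (hFc : HasCompactSupport F) (k₁ k₂ k₃ : ℕ) :
    ∫⁻ θ, symbolSeminorm k₁ (symb R F 0 θ) * symbolSeminorm k₂ (symb R F 1 θ) *
        symbolSeminorm k₃ (symb R F 2 θ) ∂(μ₀.prod (nu F)) < ∞ := by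
  set K₃ : ℝ≥0∞ := symbolSeminorm k₃ (fun _ : ℝ³ => (1 : ℂ)) with hK₃
  have hK₃lt : K₃ < ∞ := (isComplexSymbol_const (1 : ℂ)).2 k₃
  set C : ℝ := pwSymbolConst R k₁ * pwSymbolConst R k₂ with hC
  have hC0 : 0 ≤ C := mul_nonneg (pwSymbolConst_nonneg R k₁) (pwSymbolConst_nonneg R k₂)
  set b : Wsp d → ℝ≥0∞ := fun v => ENNReal.ofReal (C * (1 + ‖v‖) ^ (k₁ + k₂)) with hb
  have hbm : Measurable b :=
    ENNReal.measurable_ofReal.comp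
      (continuous_const.mul ((continuous_const.add continuous_norm).pow _)).measurable
  have hpt : ∀ θ : (Fin d → ℝ³) × Wsp d,
      symbolSeminorm k₁ (symb R F 0 θ) * symbolSeminorm k₂ (symb R F 1 θ) *
        symbolSeminorm k₃ (symb R F 2 θ) ≤ b θ.2 * K₃ := by
    intro θ
    have e1 := symbolSeminorm_symb_zero_le (F := F) R k₁ θ
    have e2 := symbolSeminorm_symb_one_le (F := F) R k₂ θ
    have e3 : symbolSeminorm k₃ (symb R F 2 θ) = K₃ := rfl
    rw [e3]
    refine mul_le_mul' ?_ le_rfl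
    calc symbolSeminorm k₁ (symb R F 0 θ) * symbolSeminorm k₂ (symb R F 1 θ)
        ≤ ENNReal.ofReal (pwSymbolConst R k₁ * (1 + ‖θ.2‖) ^ k₁) *
            ENNReal.ofReal (pwSymbolConst R k₂ * (1 + ‖θ.2‖) ^ k₂) := mul_le_mul' e1 e2
      _ = b θ.2 := by
          rw [hb, ← ENNReal.ofReal_mul (mul_nonneg (pwSymbolConst_nonneg R k₁) (by positivity))]
          congr 1
          rw [hC]
          ring
  have hfin : ∫⁻ v, b v ∂(nu F) < ∞ := by
    rw [lintegral_nu hF hFc hbm]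
    have hg := ((integrable_one_add_norm_pow_mul_Ghat hF hFc (k₁ + k₂)).const_mul C).2
    rw [hasFiniteIntegral_iff_enorm] at hg
    refine lt_of_le_of_lt (le_of_eq (lintegral_congr fun v => ?_)) hg
    have hnn : 0 ≤ C * ((1 + ‖v‖) ^ (k₁ + k₂) * ‖Ghat F v‖) := mul_nonneg hC0 (by positivity)
    rw [hb, Real.enorm_eq_ofReal hnn, ← ofReal_norm, ← ENNReal.ofReal_mul (norm_nonneg _)]
    congr 1
    ring
  calc ∫⁻ θ, symbolSeminorm k₁ (symb R F 0 θ) * symbolSeminorm k₂ (symb R F 1 θ) *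
        symbolSeminorm k₃ (symb R F 2 θ) ∂(μ₀.prod (nu F))
      ≤ ∫⁻ θ, b θ.2 * K₃ ∂(μ₀.prod (nu F)) := lintegral_mono hpt
    _ = (∫⁻ θ, b θ.2 ∂(μ₀.prod (nu F))) * K₃ := lintegral_mul_const _ (hbm.comp measurable_snd)
    _ = (∫⁻ ω, ∫⁻ v, b v ∂(nu F) ∂μ₀) * K₃ := by
        haveI := isFiniteMeasure_nu hF hFc
        have hbm2 : AEMeasurable (fun θ : (Fin d → ℝ³) × Wsp d => b θ.2) (μ₀.prod (nu F)) :=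
          (hbm.comp measurable_snd).aemeasurable
        rw [lintegral_prod _ hbm2]
    _ = (∫⁻ v, b v ∂(nu F)) * μ₀ univ * K₃ := by rw [lintegral_const]
    _ < ∞ := ENNReal.mul_lt_top (ENNReal.mul_lt_top hfin (measure_lt_top μ₀ _)) hK₃lt

variable [IsFiniteMeasure μ₀] (hE : IsRotationFamily E)
  (hF : ContDiff ℝ ((⊤ : ℕ∞) : WithTop ℕ∞) F) (hFc : HasCompactSupport F)

/-- **The complex averaging datum of the plane-wave synthesis** (Tao 2016, §3.6, last paragraph):
`Ω = V × (V̂ × ℝ³ × ℝ³)` with `μ = μ₀ ⊗ |f̂| dv`, symbols the plane-wave-twisted bumps (the first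
one carrying the unimodular factor `f̂/|f̂| · e^{2πi φ}`), rotations `R_{j,(ω,v)} = Eⱼ(ω)`, no
dilations. [cite: Tao2016AveragedNS, §3.6 p. 18 and Def. 3.4] -/
def datum : ComplexAveragingDatum where
  Ω := (Fin d → ℝ³) × Wsp d
  mΩ := inferInstance
  μ := μ₀.prod (nu F)
  isFinite := by
    haveI := isFiniteMeasure_nu hF hFc
    infer_instance
  m := symb (Rad hFc) F
  R := fun i θ => E i θ.1
  lam := fun _ _ => 1
  isComplexSymbol := fun i θ => isComplexSymbol_symb (Rad hFc) i θ
  det_R := fun i θ => hE.1 i θ.1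
  lam_pos := fun _ _ => one_pos
  lam_bdd := ⟨1, fun _ _ => ⟨by norm_num, le_rfl⟩⟩
  moment := fun k₁ k₂ k₃ => moment_lt_top μ₀ (Rad hFc) hF hFc k₁ k₂ k₃
  measurable_m := fun i ξ _ => measurable_symb_apply (Rad hFc) hF hFc i ξ
  measurable_R := fun i x => (hE.2 i x).comp measurable_fst
  measurable_lam := fun _ => measurable_const

/-- The datum has no dilations (`λ ≡ 1`, (3.9)). [cite: Tao2016AveragedNS, §3.4 (3.9)] -/
theorem datum_lam (i : Fin 3) (θ : (datum μ₀ hE hF hFc).Ω) : (datum μ₀ hE hF hFc).lam i θ = 1 := rfl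

end Datum


/-! ### The synthesis identity -/

section Identity

variable {d : ℕ} (μ₀ : Measure (Fin d → ℝ³)) {E : Fin 3 → (Fin d → ℝ³) → (ℝ³ ≃ₗᵢ[ℝ] ℝ³)}
  (R ε₀ : ℝ) {F : (Fin d → ℝ³) × (ℝ³ × ℝ³) → ℂ} {X₁ X₂ X₃ : ℝ³ → ℂ³}

/-- The rotation family lifted to `Ω = V × W`. [cite: Tao2016AveragedNS, §3.6 p. 18] -/
def SΩ (E : Fin 3 → (Fin d → ℝ³) → (ℝ³ ≃ₗᵢ[ℝ] ℝ³)) :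
    Fin 3 → ((Fin d → ℝ³) × Wsp d) → (ℝ³ ≃ₗᵢ[ℝ] ℝ³) := fun j θ => E j θ.1

/-- The lifted rotation family is pointwise measurable. [folklore] -/
theorem measurable_SΩ (hE : IsRotationFamily E) : ∀ j x, Measurable fun θ : (Fin d → ℝ³) × Wsp d =>
    SΩ E j θ x := fun j x => (hE.2 j x).comp measurable_fst

/-- The `p`-integral `J(θ) = ∫ K(v; ξ₁, ξ₂) Λ(Y₁, Y₂, Y₃) dξ₁dξ₂` at `θ = (ω, v)`.
[cite: Tao2016AveragedNS, §3.6 p. 18] -/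
def J (R ε₀ : ℝ) (E : Fin 3 → (Fin d → ℝ³) → (ℝ³ ≃ₗᵢ[ℝ] ℝ³)) (X₁ X₂ X₃ : ℝ³ → ℂ³)
    (θ : (Fin d → ℝ³) × Wsp d) : ℂ :=
  ∫ p : ℝ³ × ℝ³, K d R ε₀ θ.2 p * LamRot E X₁ X₂ X₃ θ.1 p

/-- **Step A**: the frequency-side integrand of the datum is `c₀(θ) J(θ)` (trilinearity of `Λ`).
[cite: Tao2016AveragedNS, §3.6 p. 18] -/
theorem freqSideIntegrand_datum [IsFiniteMeasure μ₀] (hE : IsRotationFamily E)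
    (hF : ContDiff ℝ ((⊤ : ℕ∞) : WithTop ℕ∞) F) (hFc : HasCompactSupport F)
    (θ : (datum μ₀ hE hF hFc).Ω) (X₁ X₂ X₃ : ℝ³ → ℂ³) :
    (datum μ₀ hE hF hFc).freqSideIntegrand ε₀ θ X₁ X₂ X₃ =
      c0 F θ * J (Rad hFc) ε₀ E X₁ X₂ X₃ θ := by
  unfold ComplexAveragingDatum.freqSideIntegrand ComplexAveragingDatum.slotFreq J
  rw [← integral_const_mul]
  refine integral_congr_ae (Eventually.of_forall fun p => ?_)
  change ((freqCutoff (‖p.1 - xi0 0‖ / ε₀ ^ 2) * eta ε₀ ‖p.1‖ ‖p.2‖ ‖-p.1 - p.2‖ : ℝ) : ℂ) *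
      Λ p.1 p.2 (symb (Rad hFc) F 0 θ p.1 • rotMat (E 0 θ.1) (X₁ ((E 0 θ.1).symm p.1)))
        (symb (Rad hFc) F 1 θ p.2 • rotMat (E 1 θ.1) (X₂ ((E 1 θ.1).symm p.2)))
        (symb (Rad hFc) F 2 θ (-p.1 - p.2) • rotMat (E 2 θ.1) (X₃ ((E 2 θ.1).symm (-p.1 - p.2)))) =
    c0 F θ * (K d (Rad hFc) ε₀ θ.2 p * LamRot E X₁ X₂ X₃ θ.1 p)
  rw [Λ_smul_smul_smul, symb_zero, symb_one, symb_two]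
  unfold K LamRot wt singleScaleWeight
  simp only
  ring

/-- **Integrability of `K Λ` on `Ω × ℝ⁶`** (Tonelli and the trilinear bound).
[cite: Tao2016AveragedNS, §3.6 p. 18] -/
theorem integrable_KLam [IsFiniteMeasure μ₀] (hE : IsRotationFamily E)
    (hF : ContDiff ℝ ((⊤ : ℕ∞) : WithTop ℕ∞) F) (hFc : HasCompactSupport F)
    (h₁ : FreqIntegrable X₁) (h₂ : FreqIntegrable X₂) (h₃ : FreqIntegrable X₃) :
    Integrable (fun q : ((Fin d → ℝ³) × Wsp d) × (ℝ³ × ℝ³) =>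
        K d R ε₀ q.1.2 q.2 * LamRot (SΩ E) X₁ X₂ X₃ q.1 q.2)
      ((μ₀.prod (nu F)).prod ((volume : Measure ℝ³).prod volume)) := by
  haveI := isFiniteMeasure_nu hF hFc
  set κ : Measure ((Fin d → ℝ³) × Wsp d) := μ₀.prod (nu F) with hκ
  have hS := measurable_SΩ hE
  have hLam := aestronglyMeasurable_LamRot κ hS h₁.1.1 h₂.1.1 h₃.1.1
  have hK1 : Measurable fun q : ((Fin d → ℝ³) × Wsp d) × (ℝ³ × ℝ³) => (q.1.2, q.2) :=
    (measurable_snd.comp measurable_fst).prodMk measurable_snd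
  have hKm := (measurable_K d R ε₀).comp hK1
  have hKm' : AEStronglyMeasurable (fun q : ((Fin d → ℝ³) × Wsp d) × (ℝ³ × ℝ³) => K d R ε₀ q.1.2 q.2)
      (κ.prod ((volume : Measure ℝ³).prod volume)) := hKm.aestronglyMeasurable
  refine ⟨hKm'.mul hLam, ?_⟩
  rw [hasFiniteIntegral_iff_enorm]
  have hnp := aestronglyMeasurable_normProd κ hS h₁.1.1 h₂.1.1 h₃.1.1
  set ρ2 : ℝ := 2 * (max R 0 + 2) with hρ2
  have hρ2nn : 0 ≤ ρ2 := by rw [hρ2]; positivity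
  have hpt : ∀ q : ((Fin d → ℝ³) × Wsp d) × (ℝ³ × ℝ³),
      ‖K d R ε₀ q.1.2 q.2 * LamRot (SΩ E) X₁ X₂ X₃ q.1 q.2‖ₑ ≤
        ENNReal.ofReal ρ2 * ‖normProd (SΩ E) X₁ X₂ X₃ q.1 q.2‖ₑ := fun q => by
    rw [← ofReal_norm, Real.enorm_eq_ofReal (normProd_nonneg _ _ _ _ _ _), ← ENNReal.ofReal_mul hρ2nn]
    exact ENNReal.ofReal_le_ofReal (norm_K_mul_LamRot_le d R ε₀ (SΩ E) X₁ X₂ X₃ q.1 q.1.2 q.2)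
  have hinner : ∀ θ : (Fin d → ℝ³) × Wsp d,
      ∫⁻ p, ‖normProd (SΩ E) X₁ X₂ X₃ θ p‖ₑ ∂((volume : Measure ℝ³).prod volume) ≤
        tripleBound X₁ X₂ X₃ := fun θ => lintegral_normProd_le h₁.1.1 h₂.1.1 h₃.1.1 θ
  calc ∫⁻ q, ‖K d R ε₀ q.1.2 q.2 * LamRot (SΩ E) X₁ X₂ X₃ q.1 q.2‖ₑ
        ∂(κ.prod ((volume : Measure ℝ³).prod volume))
      ≤ ∫⁻ q, ENNReal.ofReal ρ2 * ‖normProd (SΩ E) X₁ X₂ X₃ q.1 q.2‖ₑ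
          ∂(κ.prod ((volume : Measure ℝ³).prod volume)) := lintegral_mono hpt
    _ = ENNReal.ofReal ρ2 * ∫⁻ q, ‖normProd (SΩ E) X₁ X₂ X₃ q.1 q.2‖ₑ
          ∂(κ.prod ((volume : Measure ℝ³).prod volume)) := lintegral_const_mul'' _ hnp.enorm
    _ = ENNReal.ofReal ρ2 * ∫⁻ θ, ∫⁻ p, ‖normProd (SΩ E) X₁ X₂ X₃ θ p‖ₑ
          ∂((volume : Measure ℝ³).prod volume) ∂κ := by rw [lintegral_prod _ hnp.enorm]
    _ ≤ ENNReal.ofReal ρ2 * ∫⁻ θ, tripleBound X₁ X₂ X₃ ∂κ :=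
        mul_le_mul' le_rfl (lintegral_mono hinner)
    _ = ENNReal.ofReal ρ2 * (tripleBound X₁ X₂ X₃ * κ univ) := by rw [lintegral_const]
    _ < ∞ := ENNReal.mul_lt_top ENNReal.ofReal_lt_top
        (ENNReal.mul_lt_top (tripleBound_lt_top h₁ h₂ h₃) (measure_lt_top _ _))

/-- `J` is integrable on `Ω`. [cite: Tao2016AveragedNS, §3.6 p. 18] -/
theorem integrable_J [IsFiniteMeasure μ₀] (hE : IsRotationFamily E)
    (hF : ContDiff ℝ ((⊤ : ℕ∞) : WithTop ℕ∞) F) (hFc : HasCompactSupport F)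
    (h₁ : FreqIntegrable X₁) (h₂ : FreqIntegrable X₂) (h₃ : FreqIntegrable X₃) :
    Integrable (J R ε₀ E X₁ X₂ X₃) (μ₀.prod (nu F)) := by
  haveI := isFiniteMeasure_nu hF hFc
  have h := (integrable_KLam μ₀ R ε₀ hE hF hFc h₁ h₂ h₃).integral_prod_left
  exact h

/-- **Step B, integrability**: `c₀ J` is integrable on `Ω`. [cite: Tao2016AveragedNS, §3.6 p. 18] -/
theorem integrable_c0_mul_J [IsFiniteMeasure μ₀] (hE : IsRotationFamily E)
    (hF : ContDiff ℝ ((⊤ : ℕ∞) : WithTop ℕ∞) F) (hFc : HasCompactSupport F)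
    (h₁ : FreqIntegrable X₁) (h₂ : FreqIntegrable X₂) (h₃ : FreqIntegrable X₃) :
    Integrable (fun θ => c0 F θ * J R ε₀ E X₁ X₂ X₃ θ) (μ₀.prod (nu F)) :=
  (integrable_J μ₀ R ε₀ hE hF hFc h₁ h₂ h₃).bdd_mul (measurable_c0 hF hFc).aestronglyMeasurable
    (Eventually.of_forall norm_c0_le_one)

/-- The full integrand `H_ω(v; ξ₁, ξ₂) = f̂(v) e^{2πi φ(v,ω)} K(v; ξ₁, ξ₂) Λ(Y₁, Y₂, Y₃)`.
[cite: Tao2016AveragedNS, §3.6 p. 18] -/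
def H (R ε₀ : ℝ) (E : Fin 3 → (Fin d → ℝ³) → (ℝ³ ≃ₗᵢ[ℝ] ℝ³)) (F : (Fin d → ℝ³) × (ℝ³ × ℝ³) → ℂ)
    (X₁ X₂ X₃ : ℝ³ → ℂ³) (ω : Fin d → ℝ³) (v : Wsp d) (p : ℝ³ × ℝ³) : ℂ :=
  Ghat F v * ((𝐞 (omegaPhase d v ω) : Circle) : ℂ) * (K d R ε₀ v p * LamRot E X₁ X₂ X₃ ω p)

/-- **Step C2**: `|f̂(v)| c₀(ω,v) J(ω,v) = ∫ H_ω(v; ·)`. [cite: Tao2016AveragedNS, §3.6 p. 18] -/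
theorem norm_mul_c0_mul_J (ω : Fin d → ℝ³) (v : Wsp d) :
    ((‖Ghat F v‖ : ℝ) : ℂ) * (c0 F (ω, v) * J R ε₀ E X₁ X₂ X₃ (ω, v)) =
      ∫ p, H R ε₀ E F X₁ X₂ X₃ ω v p := by
  unfold J H
  rw [← mul_assoc, ← integral_const_mul]
  refine integral_congr_ae (Eventually.of_forall fun p => ?_)
  have e : ((‖Ghat F v‖ : ℝ) : ℂ) * c0 F (ω, v) = Ghat F v * ((𝐞 (omegaPhase d v ω) : Circle) : ℂ) := by
    unfold c0
    rw [← mul_assoc, ofReal_norm_mul_phase]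
  simp only
  rw [e]

/-- **Integrability of `H_ω` on `W × ℝ⁶`** (domination by `|f̂(v)| · 2(R⁺+2) |X₁||X₂||X₃|`).
[cite: Tao2016AveragedNS, §3.6 p. 18] -/
theorem integrable_H (hF : ContDiff ℝ ((⊤ : ℕ∞) : WithTop ℕ∞) F) (hFc : HasCompactSupport F)
    (h₁ : FreqIntegrable X₁) (h₂ : FreqIntegrable X₂) (h₃ : FreqIntegrable X₃) (ω : Fin d → ℝ³) :
    Integrable (Function.uncurry (H R ε₀ E F X₁ X₂ X₃ ω))
      ((volume : Measure (Wsp d)).prod (volume : Measure (ℝ³ × ℝ³))) := by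
  have hg : Integrable (fun p : ℝ³ × ℝ³ => 2 * (max R 0 + 2) * normProd E X₁ X₂ X₃ ω p)
      (volume : Measure (ℝ³ × ℝ³)) := (integrable_normProd_at E ω h₁ h₂ h₃).const_mul _
  have hf : Integrable (fun v : Wsp d => ‖Ghat F v‖) := (integrable_Ghat hF hFc).norm
  have hdom := hf.mul_prod hg
  refine hdom.mono' ?_ (Eventually.of_forall fun z => ?_)
  · have hG : Continuous fun z : Wsp d × (ℝ³ × ℝ³) => Ghat F z.1 :=
      (continuous_Ghat hF hFc).comp continuous_fst
    have hph : Continuous fun z : Wsp d × (ℝ³ × ℝ³) => ((𝐞 (omegaPhase d z.1 ω) : Circle) : ℂ) := by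
      have h1 : Continuous fun z : Wsp d × (ℝ³ × ℝ³) => omegaPhase d z.1 ω :=
        (continuous_omegaPhase d).comp (continuous_fst.prodMk continuous_const)
      have h2 := continuous_induced_dom.comp' (Real.continuous_fourierChar.comp h1)
      exact h2
    have hKm := (measurable_K d R ε₀).aestronglyMeasurable
      (μ := (volume : Measure (Wsp d)).prod (volume : Measure (ℝ³ × ℝ³)))
    have hL0 := aestronglyMeasurable_LamRot_at E ω h₁.1.1 h₂.1.1 h₃.1.1
    have hL : AEStronglyMeasurable (fun z : Wsp d × (ℝ³ × ℝ³) => LamRot E X₁ X₂ X₃ ω z.2)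
        ((volume : Measure (Wsp d)).prod (volume : Measure (ℝ³ × ℝ³))) :=
      hL0.comp_quasiMeasurePreserving Measure.quasiMeasurePreserving_snd
    have h := (hG.mul hph).aestronglyMeasurable.mul (hKm.mul hL)
    exact h
  · change ‖H R ε₀ E F X₁ X₂ X₃ ω z.1 z.2‖ ≤ ‖Ghat F z.1‖ * (2 * (max R 0 + 2) * normProd E X₁ X₂ X₃ ω z.2)
    unfold H
    rw [norm_mul, norm_mul, Circle.norm_coe, mul_one]
    exact mul_le_mul_of_nonneg_left (norm_K_mul_LamRot_le d R ε₀ E X₁ X₂ X₃ ω z.1 z.2)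
      (norm_nonneg _)

/-- **Steps C4–C6**: the `v`-integral of `H_ω` reproduces the joint weight (Fourier inversion,
then `χ(ξ₁) χ(ξ₂) = 1` on the support of `F`). [cite: Tao2016AveragedNS, §3.6 p. 18] -/
theorem integral_H_v (hF : ContDiff ℝ ((⊤ : ℕ∞) : WithTop ℕ∞) F) (hFc : HasCompactSupport F)
    (ω : Fin d → ℝ³) (p : ℝ³ × ℝ³) :
    ∫ v, H (Rad hFc) ε₀ E F X₁ X₂ X₃ ω v p =
      wt ε₀ p * F (ω, p) * LamRot E X₁ X₂ X₃ ω p := by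
  have hH : ∀ v : Wsp d, H (Rad hFc) ε₀ E F X₁ X₂ X₃ ω v p =
      ((𝐞 ⟪v, glue d (ω, p)⟫ : ℂ) * Ghat F v) *
        (wt ε₀ p * (chiC (Rad hFc) p.1 * chiC (Rad hFc) p.2) * LamRot E X₁ X₂ X₃ ω p) := by
    intro v
    unfold H K pw
    rw [inner_glue, AddChar.map_add_eq_mul, AddChar.map_add_eq_mul, Circle.coe_mul, Circle.coe_mul]
    ring
  simp_rw [hH]
  rw [integral_mul_const, fourier_inversion_F hF hFc (ω, p)]
  by_cases hz : F (ω, p) = 0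
  · rw [hz]
    ring
  · obtain ⟨e1, e2⟩ := norm_le_Rad_of_ne_zero hFc hz
    rw [chiC, chiC, chi_eq_one e1, chi_eq_one e2]
    push_cast
    ring

/-- **Step C**: for each `ω`, the `ν`-average of `c₀ J` is the joint-weight integrand.
[cite: Tao2016AveragedNS, §3.6 p. 18] -/
theorem inner_identity (hF : ContDiff ℝ ((⊤ : ℕ∞) : WithTop ℕ∞) F) (hFc : HasCompactSupport F)
    (h₁ : FreqIntegrable X₁) (h₂ : FreqIntegrable X₂) (h₃ : FreqIntegrable X₃) (ω : Fin d → ℝ³) :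
    ∫ v, c0 F (ω, v) * J (Rad hFc) ε₀ E X₁ X₂ X₃ (ω, v) ∂(nu F) =
      ∫ p, wt ε₀ p * F (ω, p) * LamRot E X₁ X₂ X₃ ω p := by
  rw [integral_nu hF hFc]
  simp_rw [norm_mul_c0_mul_J]
  rw [integral_integral_swap (integrable_H (Rad hFc) ε₀ hF hFc h₁ h₂ h₃ ω)]
  refine integral_congr_ae (Eventually.of_forall fun p => ?_)
  exact integral_H_v ε₀ hF hFc ω p

/-- **The synthesis identity**: the `Ω`-integral of the frequency-side integrand of the datum is
the joint-weight average ("Inserting this expansion into (3.16), we obtain the desired expansion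
(3.15)"). [cite: Tao2016AveragedNS, §3.6 p. 18] -/
theorem integral_freqSideIntegrand_datum [IsFiniteMeasure μ₀] (hE : IsRotationFamily E)
    (hF : ContDiff ℝ ((⊤ : ℕ∞) : WithTop ℕ∞) F) (hFc : HasCompactSupport F)
    (h₁ : FreqIntegrable X₁) (h₂ : FreqIntegrable X₂) (h₃ : FreqIntegrable X₃) :
    ∫ θ, (datum μ₀ hE hF hFc).freqSideIntegrand ε₀ θ X₁ X₂ X₃ ∂(datum μ₀ hE hF hFc).μ =
      jointWeightAverage μ₀ E ε₀ F X₁ X₂ X₃ := by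
  haveI := isFiniteMeasure_nu hF hFc
  have hA : ∀ θ, (datum μ₀ hE hF hFc).freqSideIntegrand ε₀ θ X₁ X₂ X₃ =
      c0 F θ * J (Rad hFc) ε₀ E X₁ X₂ X₃ θ :=
    fun θ => freqSideIntegrand_datum μ₀ ε₀ hE hF hFc θ X₁ X₂ X₃
  simp_rw [hA]
  change ∫ θ, c0 F θ * J (Rad hFc) ε₀ E X₁ X₂ X₃ θ ∂(μ₀.prod (nu F)) = _
  rw [integral_prod _ (integrable_c0_mul_J μ₀ (Rad hFc) ε₀ hE hF hFc h₁ h₂ h₃)]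
  unfold jointWeightAverage
  refine integral_congr_ae (Eventually.of_forall fun ω => ?_)
  have h := inner_identity ε₀ hF hFc h₁ h₂ h₃ ω (E := E)
  unfold wt LamRot at h
  exact h

end Identity

end PlaneWave

/-- **Tao 2016, §3.6 (last paragraph): the plane-wave synthesis holds** — every frequency-side
average with a joint smooth compactly supported weight over a measurable family of rotations is
the `Ω`-integral of the frequency-side integrand of a genuine dilation-free complex averaging
datum (`PlaneWave.datum`: `Ω = V × (V̂ × ℝ³ × ℝ³)`, `μ = μ₀ ⊗ |f̂| dv`, plane-wave-twisted bumps,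
`R_{j,(ω,v)} = Eⱼ(ω)`, `λ ≡ 1`). [cite: Tao2016AveragedNS, §3.6 p. 18 and Def. 3.4 (3.5)] -/
theorem planeWaveSynthesis_holds : planeWaveSynthesis := by
  intro d μ₀ hμ₀ E hE ε₀ F hF hFc
  haveI := hμ₀
  refine ⟨PlaneWave.datum μ₀ hE hF hFc, fun _ _ => rfl, fun X₁ X₂ X₃ h₁ h₂ h₃ => ?_⟩
  exact PlaneWave.integral_freqSideIntegrand_datum μ₀ ε₀ hE hF hFc h₁ h₂ h₃

end Literature.Analysis.FluidPDE.Tao2016
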